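import Literature.MathematicalPhysics.PowerSystems.DVOCReducedNetworkLyapunov
import Literature.MathematicalPhysics.PowerSystems.NonuniformKuramotoConnectivityCondition
import HarnessLib

/-!
# The dVOC stability condition: Condition 2 ⇒ Lemma 2 (23), and an explicit `‖𝒦 − 𝓛‖` bound
# (Groß–Colombino–Brouillon–Dörfler 2019, §IV-B Condition 2 / Prop. 2, App. proofs of Lemma 2 and
# Prop. 2; Colombino–Groß–Brouillon–Dörfler 2019, Prop. 7)

Topic `Literature/MathematicalPhysics/PowerSystems`, namespace
`Literature.MathematicalPhysics.PowerSystems.DvocReduced` (the parameter record of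
`DVOCReducedNetworkLyapunov.lean`, which this file continues). THREE COLUMNS: everything here is
MODELLED-column mathematics about the printed REDUCED-ORDER model (17) of `N` dVOC-controlled
converters on a quasi-steady-state network (model `M` = `DvocReduced N`: uniform `ℓ/r` ratio,
Kron-reduced resistive-inductive lines at steady state, consistent set-points); no declaration says
that a converter, microgrid or grid is stable. 0 named facts; every theorem is PROVED. LADDER-GRIDFUSION
«N-independent theorem track»: with this file, Proposition 3 of [GrossEtAl2019] holds for EVERY `N`
under hypotheses that are per-node / per-edge rational inequalities on the instance data plus ONE
`N × N` positive-semidefiniteness check (the algebraic-connectivity certificate), instead of the two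
`2N × 2N` PSD certificates `DecreaseOnS c` / `PhaseErrorBound κ₀` of the companion file.

Sources (held, read this session on the page; arXiv renderings, `pNNNN` = PDF page of
arXiv:1802.08881 / LaTeX chunk of arXiv:1710.00694):
* [GrossEtAl2019] D. Groß, M. Colombino, J.-S. Brouillon, F. Dörfler, *The effect of transmission-line
  dynamics on grid-forming dispatchable virtual oscillator control*, IEEE Trans. Control Netw. Syst. 6
  (2019) 1148–1160 = arXiv:1802.08881: Condition 2, Theorem 2, Prop. 2 p0005; (19)–(23), Lemma 1,
  Lemma 2, Prop. 3 p0006; App.: proof of Prop. 2 p0010 L161–L278, proof of Lemma 2 (40)–(42) p0011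
  L193–L282.
* [ColombinoEtAl2019] M. Colombino, D. Groß, J.-S. Brouillon, F. Dörfler, *Global phase and magnitude
  synchronization of coupled oscillators with application to the control of grid-forming power
  inverters*, IEEE TAC 64 (2019) 4496–4511 = arXiv:1710.00694: Prop. 7 and its proof (chunk p0014
  L35–L120: (eq. bound0), (eq. norm.bound), (eq. nonnegativity.bound), (eq. bound2)).

> [GrossEtAl2019, Condition 2] «There exists a maximal steady-state angle θ̄* ∈ [0, π/2] such that
> |θ_jk*| ≤ θ̄* holds for all (j,k) ∈ N × N. For all k ∈ N, the line admittances ‖Y_jk‖, the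
> stability margin c ∈ ℝ_{>0}, the set-points p_k*, q_k*, v_k*, and the gains η ∈ ℝ_{>0} and
> α ∈ ℝ_{>0} satisfy  Σ_{j:(j,k)∈E} ‖Y_jk‖ |1 − (v_j*/v_k*) cos(θ_jk*)| + α
> < ½(1 + cos θ̄*) (v_min*²/v_max*²) λ₂(L) − c,   η < c / (ρ‖𝒴‖(c + 5‖𝒦 − 𝓛‖)),
> where v_min* := min_k v_k* and v_max* := max_k v_k* … and λ₂(L) is the second smallest
> eigenvalue of the graph Laplacian L.»
> [Lemma 2] «Consider steady-state angles θ_jk*, α, and c such that Condition 2 is satisfied. For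
> all v ∈ ℝ^{2N}, it holds that vᵀ P_S (𝒦 − 𝓛 + α I_2N) v ≤ −c ‖v‖²_S  (23).»
> [proof, p0011] «(𝒦 − 𝓛) = (𝒦 − 𝓛)P_S. Thus, (23) is equivalent to
> vᵀ(P_S 𝒦 P_S + αP_S)v ≤ vᵀP_S 𝓛 P_S v − c‖v‖²_S (40). Noting that ½(K_k + K_kᵀ) = Σ_j ‖Y_jk‖(1 −
> (v_j*/v_k*) cos(θ_jk*)) … vᵀ[P_S𝒦P_S + αP_S]v ≤ ‖v‖²_S [max_k Σ_j ‖Y_jk‖|1 − (v_j*/v_k*)cos(θ_jk*)|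
> + α] (41). After some lengthy algebraic manipulations (see [13, Prop. 7]) …
> vᵀP_S𝓛P_Sv ≥ λ₂(L)‖v‖²_S (1/(NΣ_n v_n*²)) Σ_kΣ_j v_j*v_k* cos(θ_jk*) … Σ_kΣ_j v_j*v_k* cos(θ_jk*)
> ≥ N² v_min*² ½(1 + cos θ̄*) … vᵀP_S𝓛P_Sv ≥ ½ (v_min*²/v_max*²)(1 + cos θ̄*) λ₂(L)‖v‖²_S (42).»
> [proof of Prop. 2, p0010] «‖K_k‖ = s_k* v_k*⁻² … ‖𝓛‖ = ‖L‖ ≤ 2 max_k Σ_{j:(j,k)∈E} ‖Y_jk‖.»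

## Rendering and what is proved

* `λ₂(L)` enters, exactly as in `NonuniformKuramotoConnectivityCondition.lean` (same topic, the
  Dörfler–Bullo files), through the variational certificate
  `∀ z, λ‖Hz‖₂² ≤ N·½ΣᵢΣⱼ‖Y_ij‖(z_i − z_j)²` (`pairNormSq`, `‖Hz‖₂² = NΣz_i² − (Σz_i)²`), which holds
  iff `λ ≤ λ₂(L)` (Courant–Fischer) and is ONE `N × N` PSD check
  (`connectivity_certificate_of_posSemidef`); any certified `λ ≤ λ₂(L)` is admissible, and
  Condition 2 with `λ` in place of `λ₂(L)` is the printed condition when `λ = λ₂(L)`.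
  `v_min*`, `v_max*` are any bounds `v_min* ≤ v_k* ≤ v_max*` (print: the min and max — the weakest
  admissible choice); `θ̄` is any bound on `|θ_j − θ_k|` in `[0, π]` (print: `[0, π/2]`).
* PROVED, every `N ≥ 1`: the symmetric part of `𝒦` (`uᵀ𝒦u = Σ_k m_k‖u_k‖²`, `‖K_ku_k‖² = (m_k² +
  b_k²)‖u_k‖²`); the isoclinic-angle identity `‖𝟙⊗w‖²_S = (N − r²/Λ)|w|²` with
  `r² = ΣΣ v_j*v_k* cos θ_jk*` and the dihedral bound `‖P_{ker 𝓛} u‖² ≤ (1 − r²/(NΛ))‖u‖²` on `𝒮^⊥`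
  ([ColombinoEtAl2019, Prop. 7]'s «lengthy algebraic manipulations»); the Laplacian bound (42) in
  the sharp form `uᵀ𝓛u ≥ λ (r²/(NΛ)) ‖u‖²`; the cosine-sum bound `r² ≥ ½(1 + cos θ̄)(Σ v_k*)²` (by
  projecting the resultant on the bisector of the extreme angles — the print names the minimiser);
  **Lemma 2** in a sharp nodewise form (`decreaseOnS_of_nodewise`) and AS PRINTED
  (`decreaseOnS_of_condition2`); the operator-norm step with the explicit constant
  `κ₀ = κ_K + 2d ≥ ‖𝒦‖ + ‖𝓛‖` (`phaseErrorBound_of_bounds`, from [GrossEtAl2019, proof of Prop. 2]);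
  hence **Proposition 3's (25) under Condition 2 for every `N`** (`Vdot_le_of_condition2`); and
  Prop. 2's two ingredients: the row sum bounded by branch powers and `‖K_k‖ = s_k*/v_k*²`.
* §12 (append): **`𝒮` is invariant with logistic amplitude dynamics, and the origin is exponentially
  unstable** — the second clause of [GrossEtAl2019, Thm. 2] («the origin 0ₙ is an exponentially
  unstable equilibrium») and [ColombinoEtAl2019, Prop. 8 / proof of Prop. 10]: on the synchronous set
  the field is radial, `f(S(a,b)) = ηα(1 − (a² + b²))·S(a,b)` (`field_embS`), so `t ↦ ρ(t)S(a,b)`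
  solves (17) whenever `ρ̇ = ηα(1 − r₀²ρ²)ρ` (`isSolutionOn_ray`) and grows at least like
  `e^{ηαδt}` while `r₀²ρ² ≤ 1 − δ` (`ray_exp_growth`); the field is Fréchet differentiable at `0` with
  derivative `η((𝒦 − 𝓛) + αI₂ₙ)` (`hasFDerivAt_field_zero`, `jac0`; the cubic term `Φ` contributes
  nothing at `0`) and every `s ∈ 𝒮` is an eigenvector with eigenvalue `ηα` (`jac0_embS`).
> [ColombinoEtAl2019, proof of Prop. 8, chunk p0021 L65] «The Jacobian of f̄(v̄) at v̄ = 0 is given by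
> ∂f̄/∂v̄|_{v̄=0} = η(𝒦 − 𝓛) + αI₂ₙ. … 𝒮 ⊆ ker(𝒦 − 𝓛) … Because of α > 0, the real part of at least
> two eigenvalues of the Jacobian … is positive. Therefore, v̄ = 0 is an unstable equilibrium.»
> [proof of Prop. 10, chunk p0015 L56–L73] «the set 𝒮 is positively invariant … 𝒮 ∖ {0} is invariant
> under the dynamics.»
* NOT formalised here: Theorem 2's first clause (line dynamics (15b), singular perturbation,
  almost-global statement w.r.t. `𝒯`) and Condition 2's second (η) inequality, which only Theorem 2
  uses; the `𝒦∞` sandwich (24) (the companion file's §8 gives the sublevel bounds used downstream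
  instead); the zero-measure statement of [ColombinoEtAl2019, Prop. 8] (stable-manifold theorem).
-/

noncomputable section

namespace Literature.MathematicalPhysics.PowerSystems

open Real Finset

namespace DvocReduced

variable {N : ℕ} (W : DvocReduced N)

/-! ## §1 Elementary identities for the pairing `uᵀv` and the projector `P_S` -/

/-- `uᵀ v = vᵀ u`. [folklore] -/
private theorem dvocDot_comm (u v : DvocState N) : dvocDot u v = dvocDot v u :=
  Finset.sum_congr rfl fun k _ => by ring

/-- `(u − e)ᵀ w = uᵀ w − eᵀ w`. [folklore] -/
private theorem dvocDot_sub_left (u e w : DvocState N) :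
    dvocDot (u - e) w = dvocDot u w - dvocDot e w := by
  simp only [dvocDot, Prod.fst_sub, Prod.snd_sub, Pi.sub_apply, ← Finset.sum_sub_distrib]
  exact Finset.sum_congr rfl fun k _ => by ring

/-- Cauchy–Schwarz on `ℝ^{2N}` in the split coordinates:
`(Σ_k (p_k q_k + p'_k q'_k))² ≤ (Σ_k (p_k² + p'_k²)) (Σ_k (q_k² + q'_k²))`. [folklore] -/
private theorem cs_pair (p p' q q' : Fin N → ℝ) :
    (∑ k, (p k * q k + p' k * q' k)) ^ 2
      ≤ (∑ k, (p k ^ 2 + p' k ^ 2)) * ∑ k, (q k ^ 2 + q' k ^ 2) := by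
  have h := Finset.sum_mul_sq_le_sq_mul_sq (Finset.univ : Finset (Fin N ⊕ Fin N))
    (Sum.elim p p') (Sum.elim q q')
  simpa only [Fintype.sum_sum_type, Sum.elim_inl, Sum.elim_inr, Finset.sum_add_distrib] using h

/-- Cauchy–Schwarz: `(uᵀ z)² ≤ ‖u‖² ‖z‖²`. [folklore] -/
private theorem dvocDot_sq_le (u z : DvocState N) :
    dvocDot u z ^ 2 ≤ (∑ k, dvocNsq u k) * ∑ k, dvocNsq z k := by
  have := cs_pair u.1 u.2 z.1 z.2
  simpa only [dvocDot, dvocNsq] using this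

/-- `vᵀ P_S w = (P_S v)ᵀ w` — the projector's bilinear form is the pairing with the projection.
[cite: GrossEtAl2019, §IV-D (definition of `P_S`)] -/
theorem qS_eq_dot_projS (v w : DvocState N) : W.qS v w = dvocDot (W.projS v) w := by
  rw [projS, dvocDot_sub_left, dvocDot_comm (W.embS _ _) w, W.dot_embS]
  simp only [qS]
  ring

/-- `(P_S v)ᵀ S(a,b) = 0`: the projection is orthogonal to the synchronous subspace `𝒮`
(`Λ ≠ 0`). [cite: GrossEtAl2019, §IV-D] -/
theorem dot_projS_embS (hΛ : W.Lam ≠ 0) (v : DvocState N) (a b : ℝ) :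
    dvocDot (W.projS v) (W.embS a b) = 0 := by
  obtain ⟨h1, h2⟩ := W.sig_projS hΛ v
  rw [W.dot_embS, h1, h2]; ring

/-! ## §2 The symmetric part of `𝒦`: `½(K_k + K_kᵀ) = m_k I₂` -/

/-- The node gain `m_k := Σ_j ‖Y_jk‖ (1 − (v_j*/v_k*) cos θ_jk*)` — the diagonal of
`½(𝒦 + 𝒦ᵀ) = diag({m_k I₂}_k)`. [cite: ColombinoEtAl2019, proof of Prop. 7 (eq. bound0);
GrossEtAl2019, proof of Lemma 2 («½(K_k + K_kᵀ) = Σ_j ‖Y_jk‖(1 − (v_j*/v_k*) cos(θ_jk*))»)] -/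
def nodeGain (k : Fin N) : ℝ := ∑ j, W.w k j * (1 - W.vref j / W.vref k * cos (W.θ j - W.θ k))

/-- The Condition-2 row sum `Σ_j ‖Y_jk‖ |1 − (v_j*/v_k*) cos θ_jk*|`.
[cite: GrossEtAl2019, Condition 2] -/
def nodeGainAbs (k : Fin N) : ℝ := ∑ j, W.w k j * |1 - W.vref j / W.vref k * cos (W.θ j - W.θ k)|

/-- The skew part of `K_k`: `b_k := Σ_j ‖Y_jk‖ (v_j*/v_k*) sin θ_jk*`, so that
`K_k = m_k I₂ − b_k J`, `J = [[0,−1],[1,0]]`. [cite: ColombinoEtAl2019, eq. (Kk.def)] -/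
def nodeRot (k : Fin N) : ℝ := ∑ j, W.w k j * (W.vref j / W.vref k * sin (W.θ j - W.θ k))

/-- `K_k u_k = (m_k u_{k,1} + b_k u_{k,2}, m_k u_{k,2} − b_k u_{k,1})`.
[cite: ColombinoEtAl2019, eq. (Kk.def)] -/
theorem Kang_eq (u : DvocState N) (k : Fin N) :
    W.Kang₁ u k = W.nodeGain k * u.1 k + W.nodeRot k * u.2 k ∧
      W.Kang₂ u k = W.nodeGain k * u.2 k - W.nodeRot k * u.1 k := by
  constructor
  · simp only [Kang₁, nodeGain, nodeRot, Finset.sum_mul, ← Finset.sum_add_distrib]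
    exact Finset.sum_congr rfl fun j _ => by ring
  · simp only [Kang₂, nodeGain, nodeRot, Finset.sum_mul, ← Finset.sum_sub_distrib]
    exact Finset.sum_congr rfl fun j _ => by ring

/-- **`uᵀ 𝒦 u = Σ_k m_k ‖u_k‖²`** (only the symmetric part of `𝒦` is seen by the quadratic form).
[cite: ColombinoEtAl2019, proof of Prop. 7 (eq. bound0)] -/
theorem dot_Kang (u : DvocState N) :
    ∑ k, (u.1 k * W.Kang₁ u k + u.2 k * W.Kang₂ u k) = ∑ k, W.nodeGain k * dvocNsq u k :=
  Finset.sum_congr rfl fun k _ => by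
    obtain ⟨h1, h2⟩ := W.Kang_eq u k
    rw [h1, h2, dvocNsq]; ring

/-- `‖K_k u_k‖² = (m_k² + b_k²) ‖u_k‖²` (`K_k` is a scaled rotation). [cite: GrossEtAl2019, proof of
Prop. 2 («‖K_k‖ = s_k* v_k*⁻²»)] -/
theorem nsq_Kang (u : DvocState N) (k : Fin N) :
    W.Kang₁ u k ^ 2 + W.Kang₂ u k ^ 2 = (W.nodeGain k ^ 2 + W.nodeRot k ^ 2) * dvocNsq u k := by
  obtain ⟨h1, h2⟩ := W.Kang_eq u k
  rw [h1, h2, dvocNsq]; ring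

/-- `m_k ≤ Σ_j ‖Y_jk‖ |1 − (v_j*/v_k*) cos θ_jk*|` for nonnegative weights.
[cite: GrossEtAl2019, proof of Lemma 2 (41)] -/
theorem nodeGain_le_abs (hw : ∀ k j, 0 ≤ W.w k j) (k : Fin N) :
    W.nodeGain k ≤ W.nodeGainAbs k :=
  Finset.sum_le_sum fun j _ => mul_le_mul_of_nonneg_left (le_abs_self _) (hw k j)

/-! ## §3 The angle between `𝒮` and `ker 𝓛 = range(𝟙 ⊗ I₂)` -/

/-- The squared resultant `r² := ‖Σ_k v_k* (cos θ_k, sin θ_k)‖²` of the steady state; by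
`resultantSq_eq_sum_cos` it is the printed double sum `Σ_j Σ_k v_j* v_k* cos θ_jk*`.
[cite: ColombinoEtAl2019, proof of Prop. 7 (eq. nonnegativity.bound)–(eq. bound2)] -/
def resultantSq : ℝ := (∑ k, W.vref k * cos (W.θ k)) ^ 2 + (∑ k, W.vref k * sin (W.θ k)) ^ 2

/-- `r² = Σ_j Σ_k v_j* v_k* cos(θ_j − θ_k)`. [cite: ColombinoEtAl2019, proof of Prop. 7
(eq. nonnegativity.bound); GrossEtAl2019, proof of Lemma 2] -/
theorem resultantSq_eq_sum_cos :
    W.resultantSq = ∑ j, ∑ k, W.vref j * W.vref k * cos (W.θ j - W.θ k) := by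
  simp only [resultantSq, sq, Finset.sum_mul_sum, ← Finset.sum_add_distrib]
  refine Finset.sum_congr rfl fun j _ => Finset.sum_congr rfl fun k _ => ?_
  rw [Real.cos_sub]; ring

/-- `Sᵀ(𝟙 ⊗ (a,b))`: the two components. [cite: ColombinoEtAl2019, proof of Prop. 7 (`Iᵀ P I`)] -/
theorem sig_const (a b : ℝ) :
    W.sig₁ ((fun _ => a, fun _ => b) : DvocState N)
        = (∑ k, W.vref k * cos (W.θ k)) * a + (∑ k, W.vref k * sin (W.θ k)) * b ∧
      W.sig₂ ((fun _ => a, fun _ => b) : DvocState N)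
        = (∑ k, W.vref k * cos (W.θ k)) * b - (∑ k, W.vref k * sin (W.θ k)) * a := by
  constructor
  · simp only [sig₁, Finset.sum_mul, ← Finset.sum_add_distrib]
    exact Finset.sum_congr rfl fun k _ => by ring
  · simp only [sig₂, Finset.sum_mul, ← Finset.sum_sub_distrib]
    exact Finset.sum_congr rfl fun k _ => by ring

/-- `‖𝟙 ⊗ (a,b)‖²_S = (N − r²/Λ)(a² + b²)`: the synchronous subspace `𝒮` and `range(𝟙 ⊗ I₂)` are
isoclinic with `cos² = r²/(NΛ)`. [cite: ColombinoEtAl2019, proof of Prop. 7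
(«`1 − (1/N)‖Iᵀ P I‖ = (1/(NΣv_n*²)) Σ_k Σ_j v_j* v_k* cos θ_jk*`»)] -/
theorem normS2_const (a b : ℝ) :
    W.normS2 ((fun _ => a, fun _ => b) : DvocState N)
      = ((N : ℝ) - W.resultantSq / W.Lam) * (a ^ 2 + b ^ 2) := by
  obtain ⟨h1, h2⟩ := W.sig_const a b
  have hd : dvocDot ((fun _ => a, fun _ => b) : DvocState N) ((fun _ => a, fun _ => b) : DvocState N)
      = (N : ℝ) * (a ^ 2 + b ^ 2) := by
    simp only [dvocDot, Finset.sum_const, Finset.card_univ, Fintype.card_fin, nsmul_eq_mul]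
    ring
  simp only [normS2, qS, hd, h1, h2, resultantSq]
  ring

/-- `N − r²/Λ ≥ 0` (`Λ ≠ 0`). [cite: ColombinoEtAl2019, proof of Prop. 7 (eq. nonnegativity.bound)] -/
theorem N_sub_resultantSq_div_nonneg (hΛ : W.Lam ≠ 0) : 0 ≤ (N : ℝ) - W.resultantSq / W.Lam := by
  have h := W.normS2_nonneg hΛ ((fun _ => (1 : ℝ), fun _ => (0 : ℝ)) : DvocState N)
  rw [W.normS2_const] at h
  norm_num at h
  linarith

/-- **The dihedral bound.** For `u ⊥ 𝒮` (i.e. `Sᵀ u = 0`) the component of `u` along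
`ker 𝓛 = range(𝟙 ⊗ I₂)` is controlled by the angle between the two planes:
`(Σ_k u_{k,1})² + (Σ_k u_{k,2})² ≤ (N − r²/Λ) ‖u‖²`, i.e. `‖P_{ker 𝓛} u‖² ≤ (1 − r²/(NΛ))‖u‖²`.
[cite: ColombinoEtAl2019, proof of Prop. 7 (eq. norm.bound): «`‖P_{𝕀⊥} P v‖² ≥ ‖v‖²_S (1 −
(1/N)‖P𝕀‖²)`»] -/
theorem meanSq_le (hΛ : W.Lam ≠ 0) {u : DvocState N} (hσ : W.sig₁ u = 0 ∧ W.sig₂ u = 0) :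
    (∑ k, u.1 k) ^ 2 + (∑ k, u.2 k) ^ 2
      ≤ ((N : ℝ) - W.resultantSq / W.Lam) * ∑ k, dvocNsq u k := by
  set m₁ := ∑ k, u.1 k with hm₁
  set m₂ := ∑ k, u.2 k with hm₂
  set z : DvocState N := (fun _ => m₁, fun _ => m₂) with hz
  have hM0 : 0 ≤ m₁ ^ 2 + m₂ ^ 2 := by positivity
  have h1 : dvocDot u z = m₁ ^ 2 + m₂ ^ 2 := by
    simp only [dvocDot, hz, Finset.sum_add_distrib, ← Finset.sum_mul, ← hm₁, ← hm₂]
    ring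
  have h2 : dvocDot u z = dvocDot u (W.projS z) := by
    rw [projS, dvocDot_comm u (z - _), dvocDot_sub_left, dvocDot_comm z u,
      dvocDot_comm (W.embS _ _) u, W.dot_embS, hσ.1, hσ.2]
    ring
  have h3 : dvocDot u (W.projS z) ^ 2 ≤ (∑ k, dvocNsq u k) * ∑ k, dvocNsq (W.projS z) k :=
    dvocDot_sq_le u _
  have h4 : ∑ k, dvocNsq (W.projS z) k = ((N : ℝ) - W.resultantSq / W.Lam) * (m₁ ^ 2 + m₂ ^ 2) := by
    rw [← W.normS2_eq_sum_nsq_projS hΛ, hz, W.normS2_const]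
  have hB : 0 ≤ (N : ℝ) - W.resultantSq / W.Lam := W.N_sub_resultantSq_div_nonneg hΛ
  have hU : 0 ≤ ∑ k, dvocNsq u k := Finset.sum_nonneg fun k _ => by unfold dvocNsq; positivity
  rw [← h2, h1, h4] at h3
  rcases hM0.eq_or_lt with hMz | hMpos
  · rw [← hMz]; exact mul_nonneg hB hU
  · have h5 : (m₁ ^ 2 + m₂ ^ 2) * (m₁ ^ 2 + m₂ ^ 2)
        ≤ (((N : ℝ) - W.resultantSq / W.Lam) * ∑ k, dvocNsq u k) * (m₁ ^ 2 + m₂ ^ 2) := by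
      nlinarith [h3]
    exact le_of_mul_le_mul_right h5 hMpos

/-! ## §4 (42): `vᵀ P_S 𝓛 P_S v ≥ λ₂(L) (r²/(NΛ)) ‖v‖²_S`

The algebraic connectivity enters, as in `NonuniformKuramotoConnectivityCondition.lean`, through the
variational certificate `∀ z, λ‖Hz‖₂² ≤ N·½ΣΣ wᵢⱼ(zᵢ−zⱼ)²` (`pairNormSq`, `‖Hz‖₂² = NΣzᵢ² − (Σzᵢ)²`),
which holds iff `λ ≤ λ₂(L)` (Courant–Fischer) and is ONE `N × N` PSD check
(`connectivity_certificate_of_posSemidef`). -/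

/-- **The Laplacian lower bound behind (42)**, sharp form: for symmetric weights, `λ ≥ 0` with
`λ ≤ λ₂(L)` (variational certificate) and `u ⊥ 𝒮`,
`uᵀ 𝓛 u ≥ λ · (r²/(NΛ)) · ‖u‖²` with `r² = Σ_jΣ_k v_j* v_k* cos θ_jk*`.
[cite: GrossEtAl2019, proof of Lemma 2 («vᵀP_S𝓛P_S v ≥ λ₂(L)‖v‖²_S (1/(NΣv_n*²)) Σ_kΣ_j v_j*v_k*
cos(θ_jk*)»); ColombinoEtAl2019, proof of Prop. 7 (eq. norm.bound)–(eq. bound2)] -/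
theorem lapForm_ge [NeZero N] (hsym : ∀ k j, W.w k j = W.w j k) (hΛ : W.Lam ≠ 0) {lam : ℝ}
    (hlam0 : 0 ≤ lam)
    (hlam : ∀ z : Fin N → ℝ,
      lam * pairNormSq z ≤ N * (1 / 2 * ∑ i, ∑ j, W.w i j * (z i - z j) ^ 2))
    {u : DvocState N} (hσ : W.sig₁ u = 0 ∧ W.sig₂ u = 0) :
    lam * (W.resultantSq / (N * W.Lam)) * ∑ k, dvocNsq u k
      ≤ ∑ k, (u.1 k * W.lap₁ u k + u.2 k * W.lap₂ u k) := by
  have hN : (0 : ℝ) < N := Nat.cast_pos.2 (Nat.pos_of_ne_zero (NeZero.ne N))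
  have hq1 := hlam u.1
  have hq2 := hlam u.2
  rw [sum_sum_mul_sub_sq W.w hsym u.1, pairNormSq_eq] at hq1
  rw [sum_sum_mul_sub_sq W.w hsym u.2, pairNormSq_eq] at hq2
  have hang := W.meanSq_le hΛ hσ
  have hU : ∑ k, dvocNsq u k = ∑ k, u.1 k ^ 2 + ∑ k, u.2 k ^ 2 := by
    rw [← Finset.sum_add_distrib]
    rfl
  have hL : ∑ k, (u.1 k * W.lap₁ u k + u.2 k * W.lap₂ u k)
      = ∑ i, u.1 i * ∑ j, W.w i j * (u.1 i - u.1 j)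
        + ∑ i, u.2 i * ∑ j, W.w i j * (u.2 i - u.2 j) := by
    rw [← Finset.sum_add_distrib]
    rfl
  rw [hL]
  have hsum : lam * ((N : ℝ) * ∑ k, dvocNsq u k - ((∑ k, u.1 k) ^ 2 + (∑ k, u.2 k) ^ 2))
      ≤ N * (∑ i, u.1 i * ∑ j, W.w i j * (u.1 i - u.1 j)
        + ∑ i, u.2 i * ∑ j, W.w i j * (u.2 i - u.2 j)) := by
    rw [hU]; linarith [hq1, hq2]
  have hmono : lam * (W.resultantSq / W.Lam * ∑ k, dvocNsq u k)
      ≤ lam * ((N : ℝ) * ∑ k, dvocNsq u k - ((∑ k, u.1 k) ^ 2 + (∑ k, u.2 k) ^ 2)) := by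
    apply mul_le_mul_of_nonneg_left _ hlam0
    linarith [hang]
  have key : lam * (W.resultantSq / W.Lam) * ∑ k, dvocNsq u k
      ≤ N * (∑ i, u.1 i * ∑ j, W.w i j * (u.1 i - u.1 j)
        + ∑ i, u.2 i * ∑ j, W.w i j * (u.2 i - u.2 j)) := by
    calc lam * (W.resultantSq / W.Lam) * ∑ k, dvocNsq u k
        = lam * (W.resultantSq / W.Lam * ∑ k, dvocNsq u k) := by ring
      _ ≤ _ := hmono
      _ ≤ _ := hsum
  have hdiv : lam * (W.resultantSq / (N * W.Lam)) * ∑ k, dvocNsq u k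
      = (lam * (W.resultantSq / W.Lam) * ∑ k, dvocNsq u k) / N := by
    field_simp
  rw [hdiv, div_le_iff₀ hN]
  linarith [key]

/-! ## §5 The cosine-sum bound: `r² ≥ ½(1 + cos θ̄)(Σ_k v_k*)²` -/

/-- **The minimiser bound for the sum of cosines.** If all steady-state angle differences satisfy
`|θ_j − θ_k| ≤ θ̄` with `0 ≤ θ̄ ≤ π`, then `Σ_jΣ_k v_j* v_k* cos θ_jk* ≥ ½(1 + cos θ̄)(Σ_k v_k*)²`
(all `v_k* > 0`); print: «a minimizer for the sum of cosines is given by `θ_k1* = 0` for `k ≤ ⌈N/2⌉`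
and `θ_k1* = θ̄*` otherwise», value `N² v_min*² ½(1 + cos θ̄*)` after `Σ v_k* ≥ N v_min*`. Proof
here: project the resultant on the bisector of the extreme angles, `cos(θ_k − φ) ≥ cos(θ̄/2)`, and
`cos²(θ̄/2) = ½(1 + cos θ̄)`. [cite: GrossEtAl2019, proof of Lemma 2 (the display before (42))] -/
theorem resultantSq_ge [NeZero N] (hv : ∀ k, 0 < W.vref k) {θbar : ℝ} (hθ0 : 0 ≤ θbar)
    (hθπ : θbar ≤ π) (hang : ∀ j k, |W.θ j - W.θ k| ≤ θbar) :
    (1 + cos θbar) / 2 * (∑ k, W.vref k) ^ 2 ≤ W.resultantSq := by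
  obtain ⟨jhi, -, hhi⟩ := Finset.exists_max_image Finset.univ W.θ Finset.univ_nonempty
  obtain ⟨jlo, -, hlo⟩ := Finset.exists_min_image Finset.univ W.θ Finset.univ_nonempty
  have hspread : W.θ jhi - W.θ jlo ≤ θbar := (le_abs_self _).trans (hang jhi jlo)
  have habs : ∀ k, |W.θ k - (W.θ jhi + W.θ jlo) / 2| ≤ θbar / 2 := fun k => by
    have h1 := hhi k (Finset.mem_univ k)
    have h2 := hlo k (Finset.mem_univ k)
    rw [abs_le]; constructor <;> linarith
  have hcos : ∀ k, cos (θbar / 2) ≤ cos (W.θ k - (W.θ jhi + W.θ jlo) / 2) := fun k => by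
    rw [← Real.cos_abs (W.θ k - (W.θ jhi + W.θ jlo) / 2)]
    exact Real.cos_le_cos_of_nonneg_of_le_pi (abs_nonneg _) (by linarith) (habs k)
  have hc0 : 0 ≤ cos (θbar / 2) :=
    Real.cos_nonneg_of_mem_Icc ⟨by linarith [Real.pi_pos], by linarith⟩
  -- the projection `T` of the resultant on the bisector direction `φ`
  have hTCS : ∑ k, W.vref k * cos (W.θ k - (W.θ jhi + W.θ jlo) / 2)
      = (∑ k, W.vref k * cos (W.θ k)) * cos ((W.θ jhi + W.θ jlo) / 2)
        + (∑ k, W.vref k * sin (W.θ k)) * sin ((W.θ jhi + W.θ jlo) / 2) := by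
    simp only [Real.cos_sub, Finset.sum_mul, ← Finset.sum_add_distrib]
    exact Finset.sum_congr rfl fun k _ => by ring
  have hT_ge : cos (θbar / 2) * ∑ k, W.vref k
      ≤ ∑ k, W.vref k * cos (W.θ k - (W.θ jhi + W.θ jlo) / 2) := by
    rw [Finset.mul_sum]
    exact Finset.sum_le_sum fun k _ => by
      rw [mul_comm]; exact mul_le_mul_of_nonneg_left (hcos k) (hv k).le
  have hV0 : 0 ≤ ∑ k, W.vref k := Finset.sum_nonneg fun k _ => (hv k).le
  have hT0 : 0 ≤ cos (θbar / 2) * ∑ k, W.vref k := mul_nonneg hc0 hV0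
  have hsq : (cos (θbar / 2) * ∑ k, W.vref k) ^ 2
      ≤ (∑ k, W.vref k * cos (W.θ k - (W.θ jhi + W.θ jlo) / 2)) ^ 2 :=
    pow_le_pow_left₀ hT0 hT_ge 2
  have hr : (∑ k, W.vref k * cos (W.θ k - (W.θ jhi + W.θ jlo) / 2)) ^ 2 ≤ W.resultantSq := by
    rw [hTCS, resultantSq]
    have h2 := Real.sin_sq_add_cos_sq ((W.θ jhi + W.θ jlo) / 2)
    have hkey : (∑ k, W.vref k * cos (W.θ k)) ^ 2 + (∑ k, W.vref k * sin (W.θ k)) ^ 2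
        - ((∑ k, W.vref k * cos (W.θ k)) * cos ((W.θ jhi + W.θ jlo) / 2)
          + (∑ k, W.vref k * sin (W.θ k)) * sin ((W.θ jhi + W.θ jlo) / 2)) ^ 2
        = ((∑ k, W.vref k * cos (W.θ k)) * sin ((W.θ jhi + W.θ jlo) / 2)
          - (∑ k, W.vref k * sin (W.θ k)) * cos ((W.θ jhi + W.θ jlo) / 2)) ^ 2 := by
      linear_combination
        (-((∑ k, W.vref k * cos (W.θ k)) ^ 2 + (∑ k, W.vref k * sin (W.θ k)) ^ 2)) * h2
    nlinarith [hkey, sq_nonneg ((∑ k, W.vref k * cos (W.θ k)) * sin ((W.θ jhi + W.θ jlo) / 2)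
          - (∑ k, W.vref k * sin (W.θ k)) * cos ((W.θ jhi + W.θ jlo) / 2))]
  have hhalf : cos (θbar / 2) ^ 2 = (1 + cos θbar) / 2 := by
    rw [Real.cos_sq, show 2 * (θbar / 2) = θbar by ring]; ring
  calc (1 + cos θbar) / 2 * (∑ k, W.vref k) ^ 2 = (cos (θbar / 2) * ∑ k, W.vref k) ^ 2 := by
        rw [mul_pow, hhalf]
    _ ≤ _ := hsq
    _ ≤ W.resultantSq := hr

/-! ## §6 Lemma 2: Condition 2 ⇒ the decrease inequality (23) -/

/-- **Lemma 2, sharp nodewise form (every `N`).** For symmetric weights, set-points `v_k* > 0`, a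
certified algebraic-connectivity lower bound `λ ≥ 0` (`λ‖Hz‖₂² ≤ N·½ΣΣ‖Y_ij‖(z_i−z_j)²` for all
`z`, i.e. `λ ≤ λ₂(L)`), and the NODEWISE inequalities
`m_k + α + c ≤ λ · r²/(NΛ)` (`m_k` = `nodeGain`, `r² = ΣΣ v_j*v_k* cos θ_jk*`, `Λ = Σ v_k*²`),
the decrease inequality (23) `vᵀP_S(𝒦 − 𝓛 + αI)v ≤ −c‖v‖²_S` holds for all `v` — this is the
printed proof of Lemma 2 stopped one step before the estimates `Σv_k* ≥ N v_min*`,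
`Λ ≤ N v_max*²`, `m_k ≤ Σ_j‖Y_jk‖|1 − (v_j*/v_k*)cos θ_jk*|`. [cite: GrossEtAl2019, Lemma 2 and its
proof (40)–(42); ColombinoEtAl2019, Prop. 7] -/
theorem decreaseOnS_of_nodewise [NeZero N] (hsym : ∀ k j, W.w k j = W.w j k)
    (hv : ∀ k, 0 < W.vref k) {lam c : ℝ} (hlam0 : 0 ≤ lam)
    (hlam : ∀ z : Fin N → ℝ,
      lam * pairNormSq z ≤ N * (1 / 2 * ∑ i, ∑ j, W.w i j * (z i - z j) ^ 2))
    (hnode : ∀ k, W.nodeGain k + W.α + c ≤ lam * (W.resultantSq / (N * W.Lam))) :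
    W.DecreaseOnS c := by
  have hΛ : W.Lam ≠ 0 := (W.Lam_pos hv).ne'
  have hne : ∀ k, W.vref k ≠ 0 := fun k => (hv k).ne'
  intro v
  set u := W.projS v with hu
  have hσ : W.sig₁ u = 0 ∧ W.sig₂ u = 0 := W.sig_projS hΛ v
  have hS : W.normS2 v = ∑ k, dvocNsq u k := W.normS2_eq_sum_nsq_projS hΛ v
  -- `vᵀ P_S e_θ(v) = uᵀ e_θ(u) = uᵀ 𝒦 u − uᵀ 𝓛 u`  ((𝒦 − 𝓛) = (𝒦 − 𝓛) P_S)
  have hq : W.qS v (W.eθ v) = ∑ k, (u.1 k * W.Kang₁ u k + u.2 k * W.Kang₂ u k)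
      - ∑ k, (u.1 k * W.lap₁ u k + u.2 k * W.lap₂ u k) := by
    rw [W.qS_eq_dot_projS, ← hu, dvocDot, ← Finset.sum_sub_distrib]
    refine Finset.sum_congr rfl fun k _ => ?_
    obtain ⟨e1, e2⟩ := W.eθ_projS hne v k
    have h1 : (W.eθ v).1 k = W.Kang₁ u k - W.lap₁ u k := by
      simp only [eθ]; rw [← e1, W.eθ₁_eq_K_sub_lap]
    have h2 : (W.eθ v).2 k = W.Kang₂ u k - W.lap₂ u k := by
      simp only [eθ]; rw [← e2, W.eθ₂_eq_K_sub_lap]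
    rw [h1, h2]; ring
  rw [hq, W.dot_Kang, hS]
  have hL := W.lapForm_ge hsym hΛ hlam0 hlam hσ
  have hK : ∑ k, W.nodeGain k * dvocNsq u k + (W.α + c) * ∑ k, dvocNsq u k
      ≤ lam * (W.resultantSq / (N * W.Lam)) * ∑ k, dvocNsq u k := by
    simp only [Finset.mul_sum, ← Finset.sum_add_distrib]
    exact Finset.sum_le_sum fun k _ => by
      have hn : 0 ≤ dvocNsq u k := by unfold dvocNsq; positivity
      have := mul_le_mul_of_nonneg_right (hnode k) hn
      linarith
  linarith

/-- **Lemma 2 (GrossEtAl2019), every `N`.** «Consider steady-state angles `θ_jk*`, `α`, and `c`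
such that Condition 2 is satisfied. For all `v ∈ ℝ^{2N}`, `vᵀP_S(𝒦 − 𝓛 + αI_{2N})v ≤ −c‖v‖²_S`
(23).» Hypotheses = the part of Condition 2 that concerns the reduced-order model, AS PRINTED:
a maximal steady-state angle `θ̄` with `|θ_jk*| ≤ θ̄` for all `j, k` (print: `θ̄ ∈ [0, π/2]`; here
`θ̄ ≤ π` suffices), and for all `k`
`Σ_j ‖Y_jk‖ |1 − (v_j*/v_k*) cos θ_jk*| + α < ½(1 + cos θ̄)(v_min*²/v_max*²) λ₂(L) − c`,
with `λ₂(L)` entering through a certified lower bound `λ` in the variational form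
`λ‖Hz‖₂² ≤ N·½ΣΣ‖Y_ij‖(z_i−z_j)²` (Courant–Fischer; ONE `N × N` PSD check,
`connectivity_certificate_of_posSemidef`), and `v_min* ≤ v_k* ≤ v_max*` any bounds (print: the min
and max). Also `α ≥ 0`, `c ≥ 0`, symmetric nonnegative weights, `v_k* > 0`, `N ≥ 1`. The second
inequality of Condition 2 (`η < c/(ρ‖𝒴‖(c + 5‖𝒦 − 𝓛‖))`) concerns the line dynamics (15b) and is
not used by Lemma 2. [cite: GrossEtAl2019, Condition 2, Lemma 2 (23), proof (40)–(42)] -/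
theorem decreaseOnS_of_condition2 [NeZero N] (hsym : ∀ k j, W.w k j = W.w j k)
    (hw : ∀ k j, 0 ≤ W.w k j) (hv : ∀ k, 0 < W.vref k) (hα : 0 ≤ W.α)
    {lam c θbar vmin vmax : ℝ} (hc : 0 ≤ c)
    (hlam : ∀ z : Fin N → ℝ,
      lam * pairNormSq z ≤ N * (1 / 2 * ∑ i, ∑ j, W.w i j * (z i - z j) ^ 2))
    (hθ0 : 0 ≤ θbar) (hθπ : θbar ≤ π) (hang : ∀ j k, |W.θ j - W.θ k| ≤ θbar)
    (hvmin : 0 < vmin) (hmin : ∀ k, vmin ≤ W.vref k) (hmax : ∀ k, W.vref k ≤ vmax)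
    (hcond : ∀ k,
      W.nodeGainAbs k + W.α < (1 + cos θbar) / 2 * (vmin ^ 2 / vmax ^ 2) * lam - c) :
    W.DecreaseOnS c := by
  have hN : (0 : ℝ) < N := Nat.cast_pos.2 (Nat.pos_of_ne_zero (NeZero.ne N))
  have hΛpos : 0 < W.Lam := W.Lam_pos hv
  have k0 : Fin N := ⟨0, Nat.pos_of_ne_zero (NeZero.ne N)⟩
  have hvmax : 0 < vmax := lt_of_lt_of_le hvmin ((hmin k0).trans (hmax k0))
  have h1c : 0 ≤ (1 + cos θbar) / 2 := by linarith [Real.neg_one_le_cos θbar]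
  have hγ0 : 0 ≤ (1 + cos θbar) / 2 * (vmin ^ 2 / vmax ^ 2) := mul_nonneg h1c (by positivity)
  have hA0 : 0 ≤ W.nodeGainAbs k0 :=
    Finset.sum_nonneg fun j _ => mul_nonneg (hw k0 j) (abs_nonneg _)
  -- `λ ≥ 0` is forced by Condition 2 (`γλ > c ≥ 0`, `γ ≥ 0`)
  have hlam0 : 0 ≤ lam := by
    by_contra hneg
    have hneg' : lam < 0 := lt_of_not_ge hneg
    have h := hcond k0
    have : (1 + cos θbar) / 2 * (vmin ^ 2 / vmax ^ 2) * lam ≤ 0 :=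
      mul_nonpos_iff.2 (Or.inl ⟨hγ0, hneg'.le⟩)
    linarith
  -- the printed constant is below the sharp one: `½(1+cos θ̄) v_min²/v_max² ≤ r²/(NΛ)`
  have hγ : (1 + cos θbar) / 2 * (vmin ^ 2 / vmax ^ 2) ≤ W.resultantSq / (N * W.Lam) := by
    have hr := W.resultantSq_ge hv hθ0 hθπ hang
    have hsumv : (N : ℝ) * vmin ≤ ∑ k, W.vref k := by
      have := Finset.sum_le_sum fun k (_ : k ∈ Finset.univ) => hmin k
      simpa [Finset.sum_const, Finset.card_univ, Fintype.card_fin, nsmul_eq_mul] using this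
    have hΛle : W.Lam ≤ N * vmax ^ 2 := by
      have := Finset.sum_le_sum fun k (_ : k ∈ Finset.univ) =>
        pow_le_pow_left₀ (hv k).le (hmax k) 2
      simpa [Lam, Finset.sum_const, Finset.card_univ, Fintype.card_fin, nsmul_eq_mul] using this
    rw [le_div_iff₀ (by positivity)]
    have hvmax0 : vmax ≠ 0 := hvmax.ne'
    calc (1 + cos θbar) / 2 * (vmin ^ 2 / vmax ^ 2) * (N * W.Lam)
        ≤ (1 + cos θbar) / 2 * (vmin ^ 2 / vmax ^ 2) * (N * (N * vmax ^ 2)) := by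
          apply mul_le_mul_of_nonneg_left _ hγ0
          exact mul_le_mul_of_nonneg_left hΛle hN.le
      _ = (1 + cos θbar) / 2 * ((N : ℝ) * vmin) ^ 2 := by
          field_simp
      _ ≤ (1 + cos θbar) / 2 * (∑ k, W.vref k) ^ 2 := by
          apply mul_le_mul_of_nonneg_left _ h1c
          exact pow_le_pow_left₀ (by positivity) hsumv 2
      _ ≤ W.resultantSq := hr
  refine W.decreaseOnS_of_nodewise hsym hv hlam0 hlam fun k => ?_
  have h1 := W.nodeGain_le_abs hw k
  have h2 := hcond k
  have h3 := mul_le_mul_of_nonneg_left hγ hlam0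
  linarith

/-! ## §7 An explicit phase-error bound: `‖𝒦 − 𝓛‖ ≤ max_k ‖K_k‖ + 2 d_max` -/

/-- **`‖𝓛 u‖² ≤ (2d)² ‖u‖²`** for symmetric nonnegative weights with weighted degrees
`Σ_j ‖Y_jk‖ ≤ d` (`d ≥ 0`) — the elementary form of «`‖𝓛‖ = ‖L‖ ≤ 2 max_k Σ_{j:(j,k)∈E} ‖Y_jk‖`».
[cite: GrossEtAl2019, proof of Prop. 2] -/
theorem nsq_lap_le (hsym : ∀ k j, W.w k j = W.w j k) (hw : ∀ k j, 0 ≤ W.w k j) {d : ℝ}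
    (hd0 : 0 ≤ d) (hd : ∀ k, ∑ j, W.w k j ≤ d) (u : DvocState N) :
    ∑ k, (W.lap₁ u k ^ 2 + W.lap₂ u k ^ 2) ≤ (2 * d) ^ 2 * ∑ k, dvocNsq u k := by
  -- weighted Cauchy–Schwarz per node and component
  have hcs : ∀ (z : Fin N → ℝ) (k : Fin N),
      (∑ j, W.w k j * (z k - z j)) ^ 2 ≤ (∑ j, W.w k j) * ∑ j, W.w k j * (z k - z j) ^ 2 := by
    intro z k
    have h := Finset.sum_mul_sq_le_sq_mul_sq Finset.univ
      (fun j => Real.sqrt (W.w k j)) (fun j => Real.sqrt (W.w k j) * (z k - z j))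
    have e1 : ∀ j, Real.sqrt (W.w k j) * (Real.sqrt (W.w k j) * (z k - z j))
        = W.w k j * (z k - z j) :=
      fun j => by rw [← mul_assoc, Real.mul_self_sqrt (hw k j)]
    have e2 : ∀ j, Real.sqrt (W.w k j) ^ 2 = W.w k j := fun j => Real.sq_sqrt (hw k j)
    have e3 : ∀ j, (Real.sqrt (W.w k j) * (z k - z j)) ^ 2 = W.w k j * (z k - z j) ^ 2 :=
      fun j => by rw [mul_pow, e2]
    simp only [e1, e2, e3] at h
    exact h
  have hnode : ∀ k, W.lap₁ u k ^ 2 + W.lap₂ u k ^ 2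
      ≤ d * ∑ j, W.w k j * ((u.1 k - u.1 j) ^ 2 + (u.2 k - u.2 j) ^ 2) := by
    intro k
    have hA0 : 0 ≤ ∑ j, W.w k j * (u.1 k - u.1 j) ^ 2 :=
      Finset.sum_nonneg fun j _ => mul_nonneg (hw k j) (sq_nonneg _)
    have hB0 : 0 ≤ ∑ j, W.w k j * (u.2 k - u.2 j) ^ 2 :=
      Finset.sum_nonneg fun j _ => mul_nonneg (hw k j) (sq_nonneg _)
    have e1 : W.lap₁ u k ^ 2 ≤ d * ∑ j, W.w k j * (u.1 k - u.1 j) ^ 2 :=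
      (hcs u.1 k).trans (mul_le_mul_of_nonneg_right (hd k) hA0)
    have e2 : W.lap₂ u k ^ 2 ≤ d * ∑ j, W.w k j * (u.2 k - u.2 j) ^ 2 :=
      (hcs u.2 k).trans (mul_le_mul_of_nonneg_right (hd k) hB0)
    have hsplit : ∑ j, W.w k j * ((u.1 k - u.1 j) ^ 2 + (u.2 k - u.2 j) ^ 2)
        = ∑ j, W.w k j * (u.1 k - u.1 j) ^ 2 + ∑ j, W.w k j * (u.2 k - u.2 j) ^ 2 := by
      rw [← Finset.sum_add_distrib]
      exact Finset.sum_congr rfl fun j _ => by ring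
    rw [hsplit, mul_add]
    exact add_le_add e1 e2
  have hpair : ∀ k j, W.w k j * ((u.1 k - u.1 j) ^ 2 + (u.2 k - u.2 j) ^ 2)
      ≤ W.w k j * (2 * dvocNsq u k + 2 * dvocNsq u j) := fun k j =>
    mul_le_mul_of_nonneg_left (by
      unfold dvocNsq
      nlinarith [sq_nonneg (u.1 k + u.1 j), sq_nonneg (u.2 k + u.2 j)]) (hw k j)
  have hsymsum : ∑ k, ∑ j, W.w k j * dvocNsq u j = ∑ k, ∑ j, W.w k j * dvocNsq u k := by
    rw [Finset.sum_comm]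
    exact Finset.sum_congr rfl fun k _ => Finset.sum_congr rfl fun j _ => by rw [hsym]
  have hdeg : ∑ k, ∑ j, W.w k j * dvocNsq u k ≤ d * ∑ k, dvocNsq u k := by
    rw [Finset.mul_sum]
    exact Finset.sum_le_sum fun k _ => by
      rw [← Finset.sum_mul]
      exact mul_le_mul_of_nonneg_right (hd k) (by unfold dvocNsq; positivity)
  have hexp : ∑ k, ∑ j, W.w k j * (2 * dvocNsq u k + 2 * dvocNsq u j)
      = 2 * ∑ k, ∑ j, W.w k j * dvocNsq u k + 2 * ∑ k, ∑ j, W.w k j * dvocNsq u j := by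
    rw [Finset.mul_sum, Finset.mul_sum, ← Finset.sum_add_distrib]
    refine Finset.sum_congr rfl fun k _ => ?_
    rw [Finset.mul_sum, Finset.mul_sum, ← Finset.sum_add_distrib]
    exact Finset.sum_congr rfl fun j _ => by ring
  calc ∑ k, (W.lap₁ u k ^ 2 + W.lap₂ u k ^ 2)
      ≤ ∑ k, d * ∑ j, W.w k j * ((u.1 k - u.1 j) ^ 2 + (u.2 k - u.2 j) ^ 2) :=
        Finset.sum_le_sum fun k _ => hnode k
    _ = d * ∑ k, ∑ j, W.w k j * ((u.1 k - u.1 j) ^ 2 + (u.2 k - u.2 j) ^ 2) := by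
        rw [Finset.mul_sum]
    _ ≤ d * ∑ k, ∑ j, W.w k j * (2 * dvocNsq u k + 2 * dvocNsq u j) := by
        apply mul_le_mul_of_nonneg_left _ hd0
        exact Finset.sum_le_sum fun k _ => Finset.sum_le_sum fun j _ => hpair k j
    _ = d * (4 * ∑ k, ∑ j, W.w k j * dvocNsq u k) := by rw [hexp, hsymsum]; ring
    _ ≤ d * (4 * (d * ∑ k, dvocNsq u k)) := by
        apply mul_le_mul_of_nonneg_left _ hd0
        linarith [hdeg]
    _ = (2 * d) ^ 2 * ∑ k, dvocNsq u k := by ring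

/-- `‖𝒦 u‖² ≤ κ_K² ‖u‖²` from per-node bounds `‖K_k‖² = m_k² + b_k² ≤ κ_K²` (print:
`‖𝒦‖ = max_k ‖K_k‖`). [cite: GrossEtAl2019, proof of Prop. 2] -/
theorem nsq_Kang_le {κK : ℝ} (hK : ∀ k, W.nodeGain k ^ 2 + W.nodeRot k ^ 2 ≤ κK ^ 2)
    (u : DvocState N) :
    ∑ k, (W.Kang₁ u k ^ 2 + W.Kang₂ u k ^ 2) ≤ κK ^ 2 * ∑ k, dvocNsq u k := by
  rw [Finset.mul_sum]
  exact Finset.sum_le_sum fun k _ => by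
    rw [W.nsq_Kang]
    exact mul_le_mul_of_nonneg_right (hK k) (by unfold dvocNsq; positivity)

/-- **Explicit phase-error bound (every `N`).** With per-node gain bounds `‖K_k‖² ≤ κ_K²`
(`κ_K ≥ 0`) and weighted degrees `Σ_j ‖Y_jk‖ ≤ d`, the instance property `PhaseErrorBound (κ_K + 2d)`
holds: `‖e_θ(v)‖² ≤ (κ_K + 2d)² ‖v‖²_S` for all `v` — the printed operator-norm step
`‖(𝒦 − 𝓛)v‖ ≤ ‖𝒦 − 𝓛‖‖v‖_S` with `‖𝒦 − 𝓛‖ ≤ ‖𝒦‖ + ‖𝓛‖ ≤ max_k ‖K_k‖ + 2 max_k Σ_j ‖Y_jk‖`.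
[cite: GrossEtAl2019, proof of Prop. 2 («‖𝒦‖ = max_k s_k* v_k*⁻²», «‖𝓛‖ ≤ 2 max_k Σ ‖Y_jk‖») and
proof of Prop. 3 (the `‖𝒦 − 𝓛‖` step)] -/
theorem phaseErrorBound_of_bounds [NeZero N] (hsym : ∀ k j, W.w k j = W.w j k)
    (hw : ∀ k j, 0 ≤ W.w k j) (hv : ∀ k, 0 < W.vref k) {κK d : ℝ} (hκK : 0 ≤ κK)
    (hK : ∀ k, W.nodeGain k ^ 2 + W.nodeRot k ^ 2 ≤ κK ^ 2) (hd : ∀ k, ∑ j, W.w k j ≤ d) :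
    W.PhaseErrorBound (κK + 2 * d) := by
  have hΛ : W.Lam ≠ 0 := (W.Lam_pos hv).ne'
  have hne : ∀ k, W.vref k ≠ 0 := fun k => (hv k).ne'
  have k0 : Fin N := ⟨0, Nat.pos_of_ne_zero (NeZero.ne N)⟩
  have hd0 : 0 ≤ d := (Finset.sum_nonneg fun j _ => hw k0 j).trans (hd k0)
  intro v
  set u := W.projS v with hu
  have hS : W.normS2 v = ∑ k, dvocNsq u k := W.normS2_eq_sum_nsq_projS hΛ v
  have he : ∀ k, W.eθ₁ v k = W.Kang₁ u k - W.lap₁ u k ∧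
      W.eθ₂ v k = W.Kang₂ u k - W.lap₂ u k := by
    intro k
    obtain ⟨e1, e2⟩ := W.eθ_projS hne v k
    exact ⟨by rw [← e1, W.eθ₁_eq_K_sub_lap], by rw [← e2, W.eθ₂_eq_K_sub_lap]⟩
  set A2 := ∑ k, (W.Kang₁ u k ^ 2 + W.Kang₂ u k ^ 2) with hA2
  set B2 := ∑ k, (W.lap₁ u k ^ 2 + W.lap₂ u k ^ 2) with hB2
  set X := ∑ k, (W.Kang₁ u k * W.lap₁ u k + W.Kang₂ u k * W.lap₂ u k) with hX
  set U := ∑ k, dvocNsq u k with hU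
  have hexp : ∑ k, (W.eθ₁ v k ^ 2 + W.eθ₂ v k ^ 2) = A2 - 2 * X + B2 := by
    rw [hA2, hX, hB2, Finset.mul_sum, ← Finset.sum_sub_distrib, ← Finset.sum_add_distrib]
    exact Finset.sum_congr rfl fun k _ => by rw [(he k).1, (he k).2]; ring
  have hA : A2 ≤ κK ^ 2 * U := W.nsq_Kang_le hK u
  have hB : B2 ≤ (2 * d) ^ 2 * U := W.nsq_lap_le hsym hw hd0 hd u
  have hXcs : X ^ 2 ≤ A2 * B2 :=
    cs_pair (fun k => W.Kang₁ u k) (fun k => W.Kang₂ u k) (fun k => W.lap₁ u k)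
      (fun k => W.lap₂ u k)
  have hU0 : 0 ≤ U := Finset.sum_nonneg fun k _ => by unfold dvocNsq; positivity
  have hB0 : 0 ≤ B2 := Finset.sum_nonneg fun k _ => by positivity
  have hX2 : X ^ 2 ≤ (κK * (2 * d) * U) ^ 2 := by
    calc X ^ 2 ≤ A2 * B2 := hXcs
      _ ≤ (κK ^ 2 * U) * ((2 * d) ^ 2 * U) := mul_le_mul hA hB hB0 (by positivity)
      _ = (κK * (2 * d) * U) ^ 2 := by ring
  have hXabs : -X ≤ κK * (2 * d) * U := by
    have := (abs_le_of_sq_le_sq' hX2 (by positivity)).1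
    linarith
  rw [hexp, hS]
  nlinarith [hA, hB, hXabs]

/-! ## §8 Proposition 3 under Condition 2 — hypothesis-free in (23) and in `‖𝒦 − 𝓛‖`, every `N` -/

/-- **Proposition 3 (25) from Condition 2, every `N`.** For gains `η > 0`, `α ≥ 0`, set-points
`v_k* > 0`, symmetric nonnegative weights, a margin `c > 0` with Condition 2's first inequality
(certified `λ ≤ λ₂(L)`, angle bound `θ̄`, bounds `v_min* ≤ v_k* ≤ v_max*`), and per-node data bounds
`‖K_k‖² ≤ κ_K²` (`κ_K > 0`), `Σ_j‖Y_jk‖ ≤ d`: along the reduced-order system (17) the Lyapunov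
function (19) with `α₁ = c/(5ηκ₀²)`, `κ₀ = κ_K + 2d ≥ ‖𝒦 − 𝓛‖`, satisfies
`dV/dt ≤ −α₁ ψ(v)²` (25) for all `v`. = `Vdot_le_neg_alpha1_psi_sq` with its two instance
hypotheses discharged by `decreaseOnS_of_condition2` (Lemma 2) and `phaseErrorBound_of_bounds`.
[cite: GrossEtAl2019, Prop. 3 with Lemma 2 and the proof of Prop. 2] -/
theorem Vdot_le_of_condition2 [NeZero N] (hsym : ∀ k j, W.w k j = W.w j k)
    (hw : ∀ k j, 0 ≤ W.w k j) (hη : 0 < W.η) (hα : 0 ≤ W.α) (hv : ∀ k, 0 < W.vref k)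
    {lam c θbar vmin vmax κK d : ℝ} (hc : 0 < c)
    (hlam : ∀ z : Fin N → ℝ,
      lam * pairNormSq z ≤ N * (1 / 2 * ∑ i, ∑ j, W.w i j * (z i - z j) ^ 2))
    (hθ0 : 0 ≤ θbar) (hθπ : θbar ≤ π) (hang : ∀ j k, |W.θ j - W.θ k| ≤ θbar)
    (hvmin : 0 < vmin) (hmin : ∀ k, vmin ≤ W.vref k) (hmax : ∀ k, W.vref k ≤ vmax)
    (hcond : ∀ k,
      W.nodeGainAbs k + W.α < (1 + cos θbar) / 2 * (vmin ^ 2 / vmax ^ 2) * lam - c)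
    (hκK : 0 < κK) (hK : ∀ k, W.nodeGain k ^ 2 + W.nodeRot k ^ 2 ≤ κK ^ 2)
    (hd : ∀ k, ∑ j, W.w k j ≤ d) (v : DvocState N) :
    W.Vdot (W.alpha1 c (κK + 2 * d)) v
      ≤ -(W.alpha1 c (κK + 2 * d)) * W.psi (κK + 2 * d) v ^ 2 := by
  have k0 : Fin N := ⟨0, Nat.pos_of_ne_zero (NeZero.ne N)⟩
  have hd0 : 0 ≤ d := (Finset.sum_nonneg fun j _ => hw k0 j).trans (hd k0)
  exact W.Vdot_le_neg_alpha1_psi_sq hη hα hv hc (by positivity)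
    (W.decreaseOnS_of_condition2 hsym hw hv hα hc.le hlam hθ0 hθπ hang hvmin hmin hmax hcond)
    (W.phaseErrorBound_of_bounds hsym hw hv hκK.le hK hd) v

/-! ## §9 Proposition 2 (interpretation): the Condition-2 row sum from branch powers, and
`‖K_k‖ = s_k*/v_k*²` -/

/-- Per edge: `‖Y_jk‖ |1 − (v_j*/v_k*) cos θ_jk*| ≤ (cos κ |p_jk*| + sin κ |q_jk*|)/v_k*²` for the
`κ`-form branch powers (36) and `0 ≤ κ ≤ π/2`, nonnegative weights, `v_k* ≠ 0` — from the identity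
`v_k*² ‖Y_jk‖(1 − (v_j*/v_k*) cos θ_jk*) = cos κ · p_jk* + sin κ · q_jk*`. [cite: GrossEtAl2019,
proof of Prop. 2 (first part)] -/
theorem w_mul_abs_le_branchPowers {κ : ℝ} (hκ0 : 0 ≤ κ) (hκ1 : κ ≤ π / 2)
    (hw : ∀ k j, 0 ≤ W.w k j) {k : Fin N} (hk : W.vref k ≠ 0) (j : Fin N) :
    W.w k j * |1 - W.vref j / W.vref k * cos (W.θ j - W.θ k)|
      ≤ (cos κ * |W.pBranch κ k j| + sin κ * |W.qBranch κ k j|) / W.vref k ^ 2 := by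
  have hid : W.vref k ^ 2 * (W.w k j * (1 - W.vref j / W.vref k * cos (W.θ j - W.θ k)))
      = cos κ * W.pBranch κ k j + sin κ * W.qBranch κ k j := by
    simp only [pBranch, qBranch]
    rw [Real.cos_sub (W.θ j - W.θ k) κ, Real.sin_sub (W.θ j - W.θ k) κ]
    have sc := Real.sin_sq_add_cos_sq κ
    linear_combination
      (-(W.vref k ^ 2 * (W.w k j * (1 - W.vref j / W.vref k * cos (W.θ j - W.θ k))))) * sc
  have hv2 : 0 < W.vref k ^ 2 := by positivity
  have hcκ : 0 ≤ cos κ := Real.cos_nonneg_of_mem_Icc ⟨by linarith [Real.pi_pos], hκ1⟩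
  have hsκ : 0 ≤ sin κ := Real.sin_nonneg_of_nonneg_of_le_pi hκ0 (by linarith [Real.pi_pos])
  rw [le_div_iff₀ hv2]
  calc W.w k j * |1 - W.vref j / W.vref k * cos (W.θ j - W.θ k)| * W.vref k ^ 2
      = |W.vref k ^ 2 * (W.w k j * (1 - W.vref j / W.vref k * cos (W.θ j - W.θ k)))| := by
        rw [abs_mul, abs_mul, abs_of_nonneg (hw k j), abs_of_nonneg hv2.le]; ring
    _ = |cos κ * W.pBranch κ k j + sin κ * W.qBranch κ k j| := by rw [hid]
    _ ≤ |cos κ * W.pBranch κ k j| + |sin κ * W.qBranch κ k j| := abs_add_le _ _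
    _ = cos κ * |W.pBranch κ k j| + sin κ * |W.qBranch κ k j| := by
        rw [abs_mul, abs_mul, abs_of_nonneg hcκ, abs_of_nonneg hsκ]

/-- **Proposition 2, first part (the row sum from branch powers).** Under Condition 1 in the
`κ`-form (36) with `0 ≤ κ ≤ π/2`:
`Σ_j ‖Y_jk‖ |1 − (v_j*/v_k*) cos θ_jk*| ≤ Σ_j ((cos κ/v_k*²)|p_jk*| + (sin κ/v_k*²)|q_jk*|)`,
so Prop. 2's power-flow inequality implies Condition 2's first inequality with `θ̄ = π/2`.
[cite: GrossEtAl2019, Prop. 2 and its proof] -/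
theorem nodeGainAbs_le_branchPowers {κ : ℝ} (hκ0 : 0 ≤ κ) (hκ1 : κ ≤ π / 2)
    (hw : ∀ k j, 0 ≤ W.w k j) {k : Fin N} (hk : W.vref k ≠ 0) :
    W.nodeGainAbs k
      ≤ ∑ j, (cos κ / W.vref k ^ 2 * |W.pBranch κ k j| + sin κ / W.vref k ^ 2 * |W.qBranch κ k j|) :=
  Finset.sum_le_sum fun j _ => by
    have h := W.w_mul_abs_le_branchPowers hκ0 hκ1 hw hk j
    calc W.w k j * |1 - W.vref j / W.vref k * cos (W.θ j - W.θ k)|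
        ≤ (cos κ * |W.pBranch κ k j| + sin κ * |W.qBranch κ k j|) / W.vref k ^ 2 := h
      _ = cos κ / W.vref k ^ 2 * |W.pBranch κ k j| + sin κ / W.vref k ^ 2 * |W.qBranch κ k j| := by
          ring

/-- The set-point form of `K_k` is `(1/v_k*²)R(κ)[[p,q],[−q,p]]`, a scaled rotation:
`‖K_k u_k‖² = ((p² + q²)/v_k*⁴)‖u_k‖²`. [cite: GrossEtAl2019, eq. (10) and proof of Prop. 2
(«‖K_k‖ = (1/v_k*²)√(p_k*² + q_k*²)»)] -/
theorem Kpq_nsq (κ p q vr a b : ℝ) :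
    Kpq₁ κ p q vr a b ^ 2 + Kpq₂ κ p q vr a b ^ 2
      = (1 / vr ^ 2) ^ 2 * (p ^ 2 + q ^ 2) * (a ^ 2 + b ^ 2) := by
  simp only [Kpq₁, Kpq₂]
  have sc := Real.sin_sq_add_cos_sq κ
  linear_combination ((1 / vr ^ 2) ^ 2 * ((p * a + q * b) ^ 2 + (-(q * a) + p * b) ^ 2)) * sc

/-- **`‖K_k‖ = s_k*/v_k*²`** [cite: GrossEtAl2019, proof of Prop. 2]: with CONSISTENT set-points
`p_k* = Σ_j p_jk*`, `q_k* = Σ_j q_jk*` (Condition 1, branch powers in the `κ`-form (36)) the angle-form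
gain satisfies `m_k² + b_k² = (p_k*² + q_k*²)/v_k*⁴`, i.e. `‖K_k‖² = s_k*² v_k*⁻⁴` with
`s_k* = √(p_k*² + q_k*²)` the apparent steady-state power injection (`v_k* ≠ 0`). -/
theorem KnormSq_eq_apparentPower (κ : ℝ) {k : Fin N} (hk : W.vref k ≠ 0) :
    W.nodeGain k ^ 2 + W.nodeRot k ^ 2 = (W.pSet κ k ^ 2 + W.qSet κ k ^ 2) / W.vref k ^ 4 := by
  -- evaluate both forms of `‖K_k u_k‖²` at `u_k = (1, 0)`
  set u : DvocState N := (fun _ => (1 : ℝ), fun _ => (0 : ℝ)) with hu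
  have h1 := W.nsq_Kang u k
  obtain ⟨e1, e2⟩ := W.Kpq_apply_eq_Kang_apply κ u hk
  have h2 := Kpq_nsq κ (W.pSet κ k) (W.qSet κ k) (W.vref k) (u.1 k) (u.2 k)
  rw [e1, e2, h1] at h2
  have hn : dvocNsq u k = 1 := by simp [dvocNsq, hu]
  have ha : u.1 k ^ 2 + u.2 k ^ 2 = 1 := by simp [hu]
  rw [hn, mul_one, ha, mul_one] at h2
  rw [h2]
  field_simp

/-! ## §10 Proposition 2, first part, assembled (append 2026-08-27, same sources)

[GrossEtAl2019, Prop. 2]: «Condition 2 is satisfied if the steady-state angles θ_jk*, the set-points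
p_k*, q_k*, v_k*, and the steady-state branch powers p_jk*, q_jk* satisfy Condition 1, |θ_jk*| ≤ π/2
holds for all (j,k) ∈ N × N, and for all k ∈ N … Σ_{j:(j,k)∈E} (cos κ/v_k*²)|p_jk*| +
(sin κ/v_k*²)|q_jk*| + α ≤ (v_min*²/(2 v_max*²)) λ₂(L) − c, …» (the second, `η`, inequality
concerns the line dynamics only). Composed with Lemma 2 this gives the decrease inequality (23)
directly from POWER-FLOW data. The print's chain goes through Condition 2's STRICT inequality; here
the `≤` of Prop. 2 is fed into the sharp nodewise Lemma 2 (`decreaseOnS_of_nodewise`), so no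
strictness is needed, at the price of `c > 0` (as everywhere in the paper) to get `λ ≥ 0`. -/

/-- **Proposition 2 (first part) ⇒ (23), every `N`.** Under Condition 1 in the `κ`-form (36) with
`0 ≤ κ ≤ π/2`, steady-state angles with `|θ_j − θ_k| ≤ π/2`, set-points `0 < v_min ≤ v_k* ≤ v_max`,
symmetric nonnegative weights, `α ≥ 0`, a margin `c > 0`, a certified `λ ≤ λ₂(L)` (variational
form), and the printed power-flow inequality for every node `k`,
`Σ_j ((cos κ/v_k*²)|p_jk*| + (sin κ/v_k*²)|q_jk*|) + α ≤ (v_min²/(2 v_max²)) λ − c`,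
the decrease inequality (23) `DecreaseOnS c` holds. [cite: GrossEtAl2019, Prop. 2 with Lemma 2] -/
theorem decreaseOnS_of_proposition2 [NeZero N] (hsym : ∀ k j, W.w k j = W.w j k)
    (hw : ∀ k j, 0 ≤ W.w k j) (hv : ∀ k, 0 < W.vref k) (hα : 0 ≤ W.α)
    {κ lam c vmin vmax : ℝ} (hκ0 : 0 ≤ κ) (hκ1 : κ ≤ π / 2) (hc : 0 < c)
    (hlam : ∀ z : Fin N → ℝ,
      lam * pairNormSq z ≤ N * (1 / 2 * ∑ i, ∑ j, W.w i j * (z i - z j) ^ 2))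
    (hang : ∀ j k, |W.θ j - W.θ k| ≤ π / 2)
    (hvmin : 0 < vmin) (hmin : ∀ k, vmin ≤ W.vref k) (hmax : ∀ k, W.vref k ≤ vmax)
    (hprop2 : ∀ k, ∑ j, (cos κ / W.vref k ^ 2 * |W.pBranch κ k j|
        + sin κ / W.vref k ^ 2 * |W.qBranch κ k j|) + W.α ≤ vmin ^ 2 / (2 * vmax ^ 2) * lam - c) :
    W.DecreaseOnS c := by
  have hN : (0 : ℝ) < N := Nat.cast_pos.2 (Nat.pos_of_ne_zero (NeZero.ne N))
  have hΛpos : 0 < W.Lam := W.Lam_pos hv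
  have k0 : Fin N := ⟨0, Nat.pos_of_ne_zero (NeZero.ne N)⟩
  have hvmax : 0 < vmax := lt_of_lt_of_le hvmin ((hmin k0).trans (hmax k0))
  have hγ0 : 0 ≤ vmin ^ 2 / (2 * vmax ^ 2) := by positivity
  -- the row sums are below the power-flow expression (Prop. 2's first step)
  have hrow : ∀ k, W.nodeGainAbs k ≤ ∑ j, (cos κ / W.vref k ^ 2 * |W.pBranch κ k j|
      + sin κ / W.vref k ^ 2 * |W.qBranch κ k j|) := fun k =>
    W.nodeGainAbs_le_branchPowers hκ0 hκ1 hw (hv k).ne'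
  -- `λ > 0` from the inequality at any node (`c > 0`, everything else `≥ 0`)
  have hA0 : 0 ≤ W.nodeGainAbs k0 :=
    Finset.sum_nonneg fun j _ => mul_nonneg (hw k0 j) (abs_nonneg _)
  have hlam0 : 0 ≤ lam := by
    by_contra hneg
    have hneg' : lam < 0 := lt_of_not_ge hneg
    have h := hprop2 k0
    have h' := hrow k0
    have : vmin ^ 2 / (2 * vmax ^ 2) * lam ≤ 0 := mul_nonpos_iff.2 (Or.inl ⟨hγ0, hneg'.le⟩)
    linarith
  -- the printed constant with `θ̄ = π/2` is below the sharp one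
  have hγ : vmin ^ 2 / (2 * vmax ^ 2) ≤ W.resultantSq / (N * W.Lam) := by
    have hr := W.resultantSq_ge hv (le_of_lt Real.pi_div_two_pos) (by linarith [Real.pi_pos]) hang
    rw [Real.cos_pi_div_two, add_zero] at hr
    have hsumv : (N : ℝ) * vmin ≤ ∑ k, W.vref k := by
      have := Finset.sum_le_sum fun k (_ : k ∈ Finset.univ) => hmin k
      simpa [Finset.sum_const, Finset.card_univ, Fintype.card_fin, nsmul_eq_mul] using this
    have hΛle : W.Lam ≤ N * vmax ^ 2 := by
      have := Finset.sum_le_sum fun k (_ : k ∈ Finset.univ) =>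
        pow_le_pow_left₀ (hv k).le (hmax k) 2
      simpa [Lam, Finset.sum_const, Finset.card_univ, Fintype.card_fin, nsmul_eq_mul] using this
    rw [le_div_iff₀ (by positivity)]
    have hvmax0 : vmax ≠ 0 := hvmax.ne'
    calc vmin ^ 2 / (2 * vmax ^ 2) * (N * W.Lam)
        ≤ vmin ^ 2 / (2 * vmax ^ 2) * (N * (N * vmax ^ 2)) := by
          apply mul_le_mul_of_nonneg_left _ hγ0
          exact mul_le_mul_of_nonneg_left hΛle hN.le
      _ = 1 / 2 * ((N : ℝ) * vmin) ^ 2 := by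
          field_simp
      _ ≤ 1 / 2 * (∑ k, W.vref k) ^ 2 := by
          apply mul_le_mul_of_nonneg_left _ (by norm_num)
          exact pow_le_pow_left₀ (by positivity) hsumv 2
      _ ≤ W.resultantSq := hr
  refine W.decreaseOnS_of_nodewise hsym hv hlam0 hlam fun k => ?_
  have h1 := W.nodeGain_le_abs hw k
  have h2 := hprop2 k
  have h3 := hrow k
  have h4 := mul_le_mul_of_nonneg_left hγ hlam0
  linarith

/-! ## §11 Exponential phase stability (append 2026-08-27, same sources)

[GrossEtAl2019, §V-B p0009]: «It should be noted that Condition 2 ensures exponential phase stability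
of the reduced-order system (17), i.e., using the same steps as in Prop. 3 it can be shown that
d/dt ½‖v‖²_S ≤ −ηc‖v‖²_S.» = [ColombinoEtAl2019, Thm. 2 (Exponential phase stability)]: «V(v̄) =
v̄ᵀPv̄ is a Lyapunov function for the dynamical system with respect to 𝒮 … globally exponentially
stable with respect to 𝒮.» Here: the differential inequality along solutions from `DecreaseOnS c`
(the conclusion of Lemma 2) and Lemma 1, and its integrated form `‖v(t)‖²_S ≤ e^{−2ηct}‖v(0)‖²_S`
on every solution interval `[0, T]` — an N-independent CERTIFIED RATE once `c` is certified. -/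

/-- Derivative of `½‖v‖²_S` along a solution of (17): `η vᵀP_S g(v)` (= (26) with `α₁ = 0`).
[cite: GrossEtAl2019, eq. (26) and §V-B] -/
theorem hasDerivWithinAt_half_normS2 {γ : ℝ → DvocState N} {s : Set ℝ} {t : ℝ}
    (hγ : HasDerivWithinAt γ (W.field (γ t)) s t) :
    HasDerivWithinAt (fun τ => 1 / 2 * W.normS2 (γ τ)) (W.η * W.qS (γ t) (W.gVec (γ t))) s t := by
  have h := W.hasDerivWithinAt_V 0 hγ
  have hV : ∀ v : DvocState N, W.V 0 v = 1 / 2 * W.normS2 v := fun v => by simp [V]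
  have hVd : W.Vdot 0 (γ t) = W.η * W.qS (γ t) (W.gVec (γ t)) := by simp [Vdot]
  exact (h.congr_of_eventuallyEq (Filter.Eventually.of_forall fun τ => (hV (γ τ)).symm)
    (hV (γ t)).symm).congr_deriv hVd

/-- `vᵀP_S g(v) ≤ −c‖v‖²_S` from (23) and Lemma 1 («the same steps as in Prop. 3»): `g = e_θ +
αΦ(v)v`, `vᵀP_S e_θ(v) ≤ −(α + c)‖v‖²_S`, `vᵀP_SΦ(v)v ≤ ‖v‖²_S`; `α ≥ 0`, `v_k* > 0`, `N ≥ 1`.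
[cite: GrossEtAl2019, §V-B with Lemma 1 (22) and Lemma 2 (23)] -/
theorem qS_gVec_le [NeZero N] (hα : 0 ≤ W.α) (hv : ∀ k, 0 < W.vref k) {c : ℝ}
    (h23 : W.DecreaseOnS c) (v : DvocState N) : W.qS v (W.gVec v) ≤ -c * W.normS2 v := by
  rw [W.qS_gVec]
  have l1 := mul_le_mul_of_nonneg_left (W.qS_PhiVec_le_normS2 hv v) hα
  have l2 := h23 v
  linarith

/-- **The differential inequality `d/dt ½‖v‖²_S ≤ −ηc‖v‖²_S`** along solutions of (17)
(`η ≥ 0`, `α ≥ 0`, `v_k* > 0`, (23)). [cite: GrossEtAl2019, §V-B («Condition 2 ensures exponential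
phase stability of the reduced-order system (17)»); ColombinoEtAl2019, Thm. 2] -/
theorem hasDerivWithinAt_half_normS2_le [NeZero N] (hη : 0 ≤ W.η) (hα : 0 ≤ W.α)
    (hv : ∀ k, 0 < W.vref k) {c : ℝ} (h23 : W.DecreaseOnS c) {γ : ℝ → DvocState N} {s : Set ℝ}
    {t : ℝ} (hγ : HasDerivWithinAt γ (W.field (γ t)) s t) :
    ∃ d : ℝ, HasDerivWithinAt (fun τ => 1 / 2 * W.normS2 (γ τ)) d s t ∧
      d ≤ -(W.η * c) * W.normS2 (γ t) := by
  refine ⟨_, W.hasDerivWithinAt_half_normS2 hγ, ?_⟩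
  have hq := W.qS_gVec_le hα hv h23 (γ t)
  nlinarith [mul_le_mul_of_nonneg_left hq hη]

/-- **Exponential phase stability, integrated form (every `N`).** Along every solution of the
reduced-order system (17) on `[0, T]`: `‖v(t)‖²_S ≤ e^{−2ηct} ‖v(0)‖²_S` for all `t ∈ [0, T]`
(`η ≥ 0`, `α ≥ 0`, `v_k* > 0`, and the decrease inequality (23) with margin `c`, e.g. from
Condition 2 by `decreaseOnS_of_condition2`) — the distance to the synchronous set `𝒮` decays at the
certified rate `ηc`. [cite: ColombinoEtAl2019, Thm. 2 (Exponential phase stability);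
GrossEtAl2019, §V-B] -/
theorem normS2_le_exp_decay [NeZero N] (hη : 0 ≤ W.η) (hα : 0 ≤ W.α) (hv : ∀ k, 0 < W.vref k)
    {c : ℝ} (h23 : W.DecreaseOnS c) {γ : ℝ → DvocState N} {T : ℝ}
    (hsol : W.IsSolutionOn γ (Set.Icc 0 T)) {t : ℝ} (ht : t ∈ Set.Icc 0 T) :
    W.normS2 (γ t) ≤ Real.exp (-(2 * W.η * c * t)) * W.normS2 (γ 0) := by
  set k : ℝ := 2 * W.η * c with hk
  -- `g(τ) := e^{kτ} · ½‖γ τ‖²_S` is antitone on `[0, T]`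
  have hd : ∀ τ ∈ Set.Icc 0 T, HasDerivWithinAt
      (fun σ => Real.exp (k * σ) * (1 / 2 * W.normS2 (γ σ)))
      (Real.exp (k * τ) * (k * 1) * (1 / 2 * W.normS2 (γ τ))
        + Real.exp (k * τ) * (W.η * W.qS (γ τ) (W.gVec (γ τ)))) (Set.Icc 0 T) τ := by
    intro τ hτ
    have he : HasDerivWithinAt (fun σ => Real.exp (k * σ)) (Real.exp (k * τ) * (k * 1))
        (Set.Icc 0 T) τ :=
      (((hasDerivAt_id τ).const_mul k).exp).hasDerivWithinAt
    exact he.mul (W.hasDerivWithinAt_half_normS2 (hsol τ hτ))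
  have hanti : AntitoneOn (fun σ => Real.exp (k * σ) * (1 / 2 * W.normS2 (γ σ))) (Set.Icc 0 T) := by
    refine antitoneOn_of_hasDerivWithinAt_nonpos
      (f' := fun τ => Real.exp (k * τ) * (k * 1) * (1 / 2 * W.normS2 (γ τ))
        + Real.exp (k * τ) * (W.η * W.qS (γ τ) (W.gVec (γ τ))))
      (convex_Icc 0 T) (fun τ hτ => (hd τ hτ).continuousWithinAt)
      (fun τ hτ => (hd τ (interior_subset hτ)).mono interior_subset) (fun τ hτ => ?_)
    have hq := W.qS_gVec_le hα hv h23 (γ τ)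
    have he0 : 0 < Real.exp (k * τ) := Real.exp_pos _
    have hin : W.η * (c * W.normS2 (γ τ) + W.qS (γ τ) (W.gVec (γ τ))) ≤ 0 :=
      mul_nonpos_iff.2 (Or.inl ⟨hη, by linarith⟩)
    have key : Real.exp (k * τ) * (k * 1) * (1 / 2 * W.normS2 (γ τ))
        + Real.exp (k * τ) * (W.η * W.qS (γ τ) (W.gVec (γ τ)))
        = Real.exp (k * τ) * (W.η * (c * W.normS2 (γ τ) + W.qS (γ τ) (W.gVec (γ τ)))) := by
      rw [hk]; ring
    rw [key]
    exact mul_nonpos_iff.2 (Or.inl ⟨he0.le, hin⟩)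
  have h0 : (0 : ℝ) ∈ Set.Icc 0 T := Set.left_mem_Icc.2 (ht.1.trans ht.2)
  have hmono := hanti h0 ht ht.1
  -- unfold: `e^{kt} ½‖γ t‖²_S ≤ ½‖γ 0‖²_S`
  simp only [mul_zero, Real.exp_zero, one_mul] at hmono
  have he0 : 0 < Real.exp (-(k * t)) := Real.exp_pos _
  have hprod : Real.exp (-(k * t)) * Real.exp (k * t) = 1 := by
    rw [← Real.exp_add, neg_add_cancel, Real.exp_zero]
  calc W.normS2 (γ t) = Real.exp (-(k * t)) * (Real.exp (k * t) * W.normS2 (γ t)) := by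
        rw [← mul_assoc, hprod, one_mul]
    _ ≤ Real.exp (-(k * t)) * W.normS2 (γ 0) := by
        apply mul_le_mul_of_nonneg_left _ he0.le
        linarith
    _ = Real.exp (-(2 * W.η * c * t)) * W.normS2 (γ 0) := by rw [hk]

/-! ## §12 The synchronous set `𝒮` is invariant with logistic amplitude dynamics; the origin is an
exponentially unstable equilibrium (append 2026-08-27; GrossEtAl2019 Thm. 2 second clause,
ColombinoEtAl2019 Prop. 8 / Prop. 10) -/

/-- `‖(S(a,b))_k‖² = v_k*² (a² + b²)`: on the range of the `S`-matrix every node has the common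
normalised amplitude `r² = a² + b²` (the Summits-side `Lyapunov.DvocReducedRoa.nsq_embS` is the same
identity; restated because Literature cannot import Summits). [cite: GrossEtAl2019, §IV-D] -/
theorem dvocNsq_embS (a b : ℝ) (k : Fin N) :
    dvocNsq (W.embS a b) k = W.vref k ^ 2 * (a ^ 2 + b ^ 2) := by
  simp only [dvocNsq, embS]
  linear_combination (W.vref k ^ 2 * (a ^ 2 + b ^ 2)) * Real.sin_sq_add_cos_sq (W.θ k)

/-- `Φ_k(S(a,b)) = 1 − (a² + b²)` for every `k` (`v_k* ≠ 0`): the voltage-regulation error is the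
same at every node of a synchronous state. [cite: GrossEtAl2019, eq. (13) and §IV-D] -/
theorem Phi_embS (a b : ℝ) {k : Fin N} (hk : W.vref k ≠ 0) :
    W.Phi (W.embS a b) k = 1 - (a ^ 2 + b ^ 2) := by
  rw [Phi, dvocNsq_embS]
  field_simp

/-- **The reduced-order field on `𝒮` in closed form**: `f(S(a,b)) = ηα(1 − (a² + b²)) · S(a,b)`
(`v_k* ≠ 0`): the phase error vanishes on `𝒮` (`(𝒦 − 𝓛)𝒮 = 0`) and only the common amplitude
error drives the dynamics, radially. [cite: GrossEtAl2019, eq. (17) and §IV-C («(𝒦 − 𝓛)v = 0 for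
all v ∈ 𝒮»); ColombinoEtAl2019, proof of Prop. 10 («𝒮 is positively invariant»)] -/
theorem field_embS (hv : ∀ k, W.vref k ≠ 0) (a b : ℝ) :
    W.field (W.embS a b) = (W.η * W.α * (1 - (a ^ 2 + b ^ 2))) • W.embS a b := by
  refine Prod.ext (funext fun k => ?_) (funext fun k => ?_)
  · simp only [field, g₁, (W.eθ_embS a b (hv k)).1, W.Phi_embS a b (hv k), Prod.smul_fst,
      Pi.smul_apply, smul_eq_mul]
    ring
  · simp only [field, g₂, (W.eθ_embS a b (hv k)).2, W.Phi_embS a b (hv k), Prod.smul_snd,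
      Pi.smul_apply, smul_eq_mul]
    ring

/-- Scaling the `S`-embedding: `ρ · S(a,b) = S(ρa, ρb)`. [folklore] -/
private theorem smul_embS (ρ a b : ℝ) : ρ • W.embS a b = W.embS (ρ * a) (ρ * b) := by
  refine Prod.ext (funext fun k => ?_) (funext fun k => ?_)
  · simp only [embS, Prod.smul_fst, Pi.smul_apply, smul_eq_mul]
    ring
  · simp only [embS, Prod.smul_snd, Pi.smul_apply, smul_eq_mul]
    ring

/-- The field along the ray `ρ ↦ ρ · S(a,b)`: `f(ρ S(a,b)) = ηα(1 − (a² + b²)ρ²)ρ · S(a,b)`.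
[cite: GrossEtAl2019, eq. (17); ColombinoEtAl2019, proof of Prop. 10] -/
theorem field_smul_embS (hv : ∀ k, W.vref k ≠ 0) (ρ a b : ℝ) :
    W.field (ρ • W.embS a b)
      = (W.η * W.α * (1 - (a ^ 2 + b ^ 2) * ρ ^ 2) * ρ) • W.embS a b := by
  rw [W.smul_embS, W.field_embS hv, ← W.smul_embS, smul_smul]
  congr 1
  ring

/-- **`𝒮` is invariant and the dynamics on it are a scalar logistic-type equation**: if
`ρ̇ = ηα (1 − (a² + b²)ρ²) ρ` on a time set `s`, then `t ↦ ρ(t) · S(a,b)` solves the reduced-order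
system (17) on `s`. [cite: ColombinoEtAl2019, proof of Prop. 10 («𝒮 ∖ {0} is invariant under the
dynamics»); GrossEtAl2019, eq. (17)] -/
theorem isSolutionOn_ray (hv : ∀ k, W.vref k ≠ 0) (a b : ℝ) {ρ : ℝ → ℝ} {s : Set ℝ}
    (hρ : ∀ t ∈ s,
      HasDerivWithinAt ρ (W.η * W.α * (1 - (a ^ 2 + b ^ 2) * ρ t ^ 2) * ρ t) s t) :
    W.IsSolutionOn (fun t => ρ t • W.embS a b) s := by
  intro t ht
  rw [W.field_smul_embS hv]
  exact (hρ t ht).smul_const (W.embS a b)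

/-- **Exponential growth along `𝒮` below the nominal amplitude** (the nonlinear content of «the
origin is an exponentially unstable equilibrium»): if `ρ̇ = ηα(1 − r₀²ρ²)ρ` on `[0, T]` with
`ρ ≥ 0` and the normalised amplitude stays below `1 − δ` (`r₀² ρ(τ)² ≤ 1 − δ`), then
`ρ(t) ≥ e^{ηαδ t} ρ(0)` for `t ∈ [0, T]` (`η, α ≥ 0`). [cite: GrossEtAl2019, Thm. 2 («the origin 0ₙ
is an exponentially unstable equilibrium»); ColombinoEtAl2019, Prop. 8] -/
theorem ray_exp_growth (hη : 0 ≤ W.η) (hα : 0 ≤ W.α) {r0sq δ T : ℝ} {ρ : ℝ → ℝ}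
    (hρ : ∀ t ∈ Set.Icc 0 T,
      HasDerivWithinAt ρ (W.η * W.α * (1 - r0sq * ρ t ^ 2) * ρ t) (Set.Icc 0 T) t)
    (hpos : ∀ t ∈ Set.Icc 0 T, 0 ≤ ρ t) (hbelow : ∀ t ∈ Set.Icc 0 T, r0sq * ρ t ^ 2 ≤ 1 - δ)
    {t : ℝ} (ht : t ∈ Set.Icc 0 T) :
    Real.exp (W.η * W.α * δ * t) * ρ 0 ≤ ρ t := by
  set k : ℝ := W.η * W.α * δ with hk
  -- `g(τ) := e^{−kτ} ρ(τ)` is monotone on `[0, T]`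
  have hd : ∀ τ ∈ Set.Icc 0 T, HasDerivWithinAt (fun σ => Real.exp (-k * σ) * ρ σ)
      (Real.exp (-k * τ) * (-k * 1) * ρ τ
        + Real.exp (-k * τ) * (W.η * W.α * (1 - r0sq * ρ τ ^ 2) * ρ τ)) (Set.Icc 0 T) τ := by
    intro τ hτ
    have he : HasDerivWithinAt (fun σ => Real.exp (-k * σ)) (Real.exp (-k * τ) * (-k * 1))
        (Set.Icc 0 T) τ :=
      (((hasDerivAt_id τ).const_mul (-k)).exp).hasDerivWithinAt
    exact he.mul (hρ τ hτ)
  have hmono : MonotoneOn (fun σ => Real.exp (-k * σ) * ρ σ) (Set.Icc 0 T) := by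
    refine monotoneOn_of_hasDerivWithinAt_nonneg
      (f' := fun τ => Real.exp (-k * τ) * (-k * 1) * ρ τ
        + Real.exp (-k * τ) * (W.η * W.α * (1 - r0sq * ρ τ ^ 2) * ρ τ))
      (convex_Icc 0 T) (fun τ hτ => (hd τ hτ).continuousWithinAt)
      (fun τ hτ => (hd τ (interior_subset hτ)).mono interior_subset) (fun τ hτ => ?_)
    have hτ' : τ ∈ Set.Icc 0 T := interior_subset hτ
    have he0 : 0 < Real.exp (-k * τ) := Real.exp_pos _
    have key : Real.exp (-k * τ) * (-k * 1) * ρ τ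
        + Real.exp (-k * τ) * (W.η * W.α * (1 - r0sq * ρ τ ^ 2) * ρ τ)
        = Real.exp (-k * τ) * (W.η * W.α * ((1 - r0sq * ρ τ ^ 2) - δ) * ρ τ) := by
      rw [hk]; ring
    rw [key]
    refine mul_nonneg he0.le (mul_nonneg (mul_nonneg (mul_nonneg hη hα) ?_) (hpos τ hτ'))
    linarith [hbelow τ hτ']
  have h0 : (0 : ℝ) ∈ Set.Icc 0 T := Set.left_mem_Icc.2 (ht.1.trans ht.2)
  have hle := hmono h0 ht ht.1
  simp only [mul_zero, Real.exp_zero, one_mul] at hle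
  have he0 : 0 < Real.exp (k * t) := Real.exp_pos _
  have hprod : Real.exp (k * t) * Real.exp (-k * t) = 1 := by
    rw [← Real.exp_add, neg_mul, add_neg_cancel, Real.exp_zero]
  calc Real.exp (W.η * W.α * δ * t) * ρ 0 = Real.exp (k * t) * ρ 0 := by rw [hk]
    _ ≤ Real.exp (k * t) * (Real.exp (-k * t) * ρ t) := mul_le_mul_of_nonneg_left hle he0.le
    _ = ρ t := by rw [← mul_assoc, hprod, one_mul]

/-! ### The linearisation of (17) at the origin -/

/-- First-coordinate functional `v ↦ v_{k,1}` on `ℝ^{2N}`. [folklore] -/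
def c1CLM (k : Fin N) : DvocState N →L[ℝ] ℝ :=
  (ContinuousLinearMap.proj (R := ℝ) (φ := fun _ : Fin N => ℝ) k).comp
    (ContinuousLinearMap.fst ℝ (Fin N → ℝ) (Fin N → ℝ))

/-- Second-coordinate functional `v ↦ v_{k,2}`. [folklore] -/
def c2CLM (k : Fin N) : DvocState N →L[ℝ] ℝ :=
  (ContinuousLinearMap.proj (R := ℝ) (φ := fun _ : Fin N => ℝ) k).comp
    (ContinuousLinearMap.snd ℝ (Fin N → ℝ) (Fin N → ℝ))

/-- `c1CLM k v = v_{k,1}`. [folklore] -/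
@[simp] private theorem c1CLM_apply (k : Fin N) (v : DvocState N) : c1CLM k v = v.1 k := by
  simp [c1CLM]

/-- `c2CLM k v = v_{k,2}`. [folklore] -/
@[simp] private theorem c2CLM_apply (k : Fin N) (v : DvocState N) : c2CLM k v = v.2 k := by
  simp [c2CLM]

/-- The coordinates are differentiable. [folklore] -/
private theorem hasFDerivAt_c1 (x : DvocState N) (k : Fin N) :
    HasFDerivAt (fun v : DvocState N => v.1 k) (c1CLM k) x :=
  (hasFDerivAt_apply (𝕜 := ℝ) k x.1).comp x hasFDerivAt_fst

/-- The coordinates are differentiable. [folklore] -/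
private theorem hasFDerivAt_c2 (x : DvocState N) (k : Fin N) :
    HasFDerivAt (fun v : DvocState N => v.2 k) (c2CLM k) x :=
  (hasFDerivAt_apply (𝕜 := ℝ) k x.2).comp x hasFDerivAt_snd

/-- The phase-error map `v ↦ e_θ(v) = (𝒦 − 𝓛)v` as a continuous linear map. [cite: GrossEtAl2019,
eq. (12) and Prop. 1 («(𝒦 − 𝓛)v = e_θ(v)»)] -/
def eθCLM : DvocState N →L[ℝ] DvocState N :=
  (ContinuousLinearMap.pi fun k => ∑ j, W.w k j • (c1CLM j - (W.vref j / W.vref k) •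
      (cos (W.θ j - W.θ k) • c1CLM k - sin (W.θ j - W.θ k) • c2CLM k))).prod
    (ContinuousLinearMap.pi fun k => ∑ j, W.w k j • (c2CLM j - (W.vref j / W.vref k) •
      (sin (W.θ j - W.θ k) • c1CLM k + cos (W.θ j - W.θ k) • c2CLM k)))

/-- `eθCLM v = e_θ(v)`. [cite: GrossEtAl2019, eq. (12)] -/
theorem eθCLM_apply (v : DvocState N) : W.eθCLM v = W.eθ v := by
  refine Prod.ext (funext fun k => ?_) (funext fun k => ?_)
  · simp only [eθCLM, eθ, eθ₁, ContinuousLinearMap.prod_apply, ContinuousLinearMap.pi_apply,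
      FunLike.coe_sum, Finset.sum_apply, _root_.smul_apply, _root_.sub_apply, c1CLM_apply,
      c2CLM_apply, smul_eq_mul]
  · simp only [eθCLM, eθ, eθ₂, ContinuousLinearMap.prod_apply, ContinuousLinearMap.pi_apply,
      FunLike.coe_sum, Finset.sum_apply, _root_.smul_apply, _root_.sub_apply, _root_.add_apply,
      c1CLM_apply, c2CLM_apply, smul_eq_mul]

/-- **The Jacobian of the reduced-order field (17) at the origin**: `∂f/∂v(0) = η((𝒦 − 𝓛) + αI₂ₙ)`
(`Φ(0) = I`, the cubic voltage-regulation term has zero derivative at `0`). [cite: ColombinoEtAl2019,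
proof of Prop. 8 («The Jacobian of f̄(v̄) at v̄ = 0 is given by η(𝒦 − 𝓛) + αI₂ₙ»); GrossEtAl2019,
Thm. 2] -/
def jac0 : DvocState N →L[ℝ] DvocState N :=
  W.η • (W.eθCLM + W.α • ContinuousLinearMap.id ℝ (DvocState N))

/-- `∂f/∂v(0) v = η (e_θ(v) + α v)`. [cite: ColombinoEtAl2019, proof of Prop. 8] -/
theorem jac0_apply (v : DvocState N) : W.jac0 v = W.η • (W.eθ v + W.α • v) := by
  simp only [jac0, _root_.smul_apply, _root_.add_apply, ContinuousLinearMap.id_apply, eθCLM_apply]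

/-- The cubic part `(‖v_k‖²/v_k*²) v_k` of the voltage-regulation term `Φ(v)v`. [cite: GrossEtAl2019,
eq. (13)] -/
def cubicVec (v : DvocState N) : DvocState N :=
  (fun k => dvocNsq v k / W.vref k ^ 2 * v.1 k, fun k => dvocNsq v k / W.vref k ^ 2 * v.2 k)

/-- `f(v) = η(e_θ(v) + αv) − ηα · cubic(v)` (`v_k* ≠ 0`). [cite: GrossEtAl2019, eqs. (13), (17)] -/
theorem field_eq_linear_sub_cubic (hv : ∀ k, W.vref k ≠ 0) (v : DvocState N) :
    W.field v = W.η • (W.eθ v + W.α • v) - (W.η * W.α) • W.cubicVec v := by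
  refine Prod.ext (funext fun k => ?_) (funext fun k => ?_)
  · simp only [field, g₁, Phi, eθ, cubicVec, Prod.fst_sub, Prod.smul_fst, Prod.fst_add,
      Pi.sub_apply, Pi.smul_apply, Pi.add_apply, smul_eq_mul]
    field_simp [hv k]
    ring
  · simp only [field, g₂, Phi, eθ, cubicVec, Prod.snd_sub, Prod.smul_snd, Prod.snd_add,
      Pi.sub_apply, Pi.smul_apply, Pi.add_apply, smul_eq_mul]
    field_simp [hv k]
    ring

/-- `‖v_k‖²` is differentiable. [folklore] -/
private theorem hasFDerivAt_dvocNsq (x : DvocState N) (k : Fin N) :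
    HasFDerivAt (fun v : DvocState N => dvocNsq v k)
      ((2 * x.1 k) • c1CLM k + (2 * x.2 k) • c2CLM k) x := by
  unfold dvocNsq
  refine (((hasFDerivAt_c1 x k).pow 2).add ((hasFDerivAt_c2 x k).pow 2)).congr_fderiv ?_
  ext v <;> simp

/-- The cubic term has zero derivative at the origin. [cite: ColombinoEtAl2019, proof of Prop. 8] -/
theorem hasFDerivAt_cubicVec_zero :
    HasFDerivAt W.cubicVec (0 : DvocState N →L[ℝ] DvocState N) 0 := by
  have hfun : W.cubicVec = fun v => (fun k => dvocNsq v k * (W.vref k ^ 2)⁻¹ * v.1 k,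
      fun k => dvocNsq v k * (W.vref k ^ 2)⁻¹ * v.2 k) := by
    funext v
    simp only [cubicVec, div_eq_mul_inv]
  rw [hfun]
  have h1 : ∀ k, HasFDerivAt (fun v : DvocState N => dvocNsq v k * (W.vref k ^ 2)⁻¹ * v.1 k)
      (0 : DvocState N →L[ℝ] ℝ) 0 := by
    intro k
    refine (((hasFDerivAt_dvocNsq 0 k).mul_const ((W.vref k ^ 2)⁻¹)).fun_mul
      (hasFDerivAt_c1 0 k)).congr_fderiv ?_
    ext v <;> simp [dvocNsq]
  have h2 : ∀ k, HasFDerivAt (fun v : DvocState N => dvocNsq v k * (W.vref k ^ 2)⁻¹ * v.2 k)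
      (0 : DvocState N →L[ℝ] ℝ) 0 := by
    intro k
    refine (((hasFDerivAt_dvocNsq 0 k).mul_const ((W.vref k ^ 2)⁻¹)).fun_mul
      (hasFDerivAt_c2 0 k)).congr_fderiv ?_
    ext v <;> simp [dvocNsq]
  have h : HasFDerivAt (fun v : DvocState N => ((fun k => dvocNsq v k * (W.vref k ^ 2)⁻¹ * v.1 k,
      fun k => dvocNsq v k * (W.vref k ^ 2)⁻¹ * v.2 k) : DvocState N))
      ((ContinuousLinearMap.pi fun k => (0 : DvocState N →L[ℝ] ℝ)).prod
        (ContinuousLinearMap.pi fun k => (0 : DvocState N →L[ℝ] ℝ))) 0 :=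
    (hasFDerivAt_pi.2 fun k => (h1 k).congr_fderiv (by ext v <;> simp)).prodMk
      (hasFDerivAt_pi.2 fun k => (h2 k).congr_fderiv (by ext v <;> simp))
  exact h.congr_fderiv (by ext v <;> simp)

/-- **Linearisation at the origin (kernel fact)**: the reduced-order dVOC field (17) is Fréchet
differentiable at `v = 0` with derivative `jac0 = η((𝒦 − 𝓛) + αI₂ₙ)` (`v_k* ≠ 0`).
[cite: ColombinoEtAl2019, proof of Prop. 8; GrossEtAl2019, Thm. 2] -/
theorem hasFDerivAt_field_zero (hv : ∀ k, W.vref k ≠ 0) : HasFDerivAt W.field W.jac0 0 := by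
  have hfun : W.field = fun v => W.η • (W.eθCLM v + W.α • v) - (W.η * W.α) • W.cubicVec v := by
    funext v
    rw [W.field_eq_linear_sub_cubic hv, eθCLM_apply]
  rw [hfun]
  have hlin : HasFDerivAt (fun v : DvocState N => W.eθCLM v + W.α • v)
      (W.eθCLM + W.α • ContinuousLinearMap.id ℝ (DvocState N)) 0 :=
    W.eθCLM.hasFDerivAt.add ((hasFDerivAt_id (𝕜 := ℝ) (0 : DvocState N)).const_smul W.α)
  refine ((hlin.const_smul W.η).sub (W.hasFDerivAt_cubicVec_zero.const_smul (W.η * W.α))).congr_fderiv ?_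
  simp only [smul_zero, sub_zero, jac0]

/-- **The unstable eigenvalue**: every synchronous direction `s = S(a,b) ∈ 𝒮` is an eigenvector of the
linearisation at the origin with eigenvalue `ηα` (`(𝒦 − 𝓛)s = 0`), so for `η, α > 0` the origin is
an exponentially unstable equilibrium with the two-dimensional unstable eigenspace `𝒮`.
[cite: GrossEtAl2019, Thm. 2 («the origin 0ₙ is an exponentially unstable equilibrium»);
ColombinoEtAl2019, proof of Prop. 8 («𝒮 ⊆ ker(𝒦 − 𝓛) … the real part of at least two eigenvalues of
the Jacobian … is positive»)] -/
theorem jac0_embS (hv : ∀ k, W.vref k ≠ 0) (a b : ℝ) :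
    W.jac0 (W.embS a b) = (W.η * W.α) • W.embS a b := by
  rw [jac0_apply, W.eθ_of_InS ⟨a, b, rfl⟩ hv, zero_add, smul_smul]

end DvocReduced



end Literature.MathematicalPhysics.PowerSystems

end
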